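import Literature.MathematicalPhysics.QuantumLattice.KomaTasakiGriffithsTheoremProofs
import Mathlib.Analysis.MeanInequalitiesPow
import Mathlib.Algebra.Order.Ring.Pow
import HarnessLib

/-!
# Koma–Tasaki 1993, Theorem 6.1 (state form) and Corollary 2.2 — PROOF (discharge of the named
# fact `kt93_corollary_2_2`), with the `SO(2) = U(1)` extension (factor `√2`)

T. Koma, H. Tasaki, *Symmetry breaking in Heisenberg antiferromagnets*, Commun. Math. Phys. **158**
(1993) 191–214 (`KomaTasaki1993`, held as `paper:doi-10-1007-bf02097237`, read at pp. 206–208 =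
§6 "Consequence of the Symmetry", Theorem 6.1, Lemmas 6.2–6.3, and p. 197, Corollary 2.2).  Second
sibling proof file of `KomaTasakiGriffithsTheorem.lean` (statements; seat `hubbard-cq-lit-1`, cell
`pub/hubbard-cq`), after `KomaTasakiGriffithsTheoremProofs.lean` (Theorem 2.1,
`kt93_theorem_2_1_holds`): no definition and no statement is introduced here; this file proves
`theorem kt93_corollary_2_2_holds : kt93_corollary_2_2` — for `SU(2)`-symmetric models the spontaneous
(staggered) magnetisation dominates `√3` times the long-range order parameter, `m_s ≥ √3 σ` (2.18),
at every temperature ("follows from Theorem 2.1 and Theorem 6.1").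

## The printed proof (KT93 §6) and its rendering

**Theorem 6.1** (p. 206): *Let `⟨·⟩_Λ` be a state (a normalised linear functional) on the operators of
the quantum system on `Λ`, invariant under the `SU(2)` transformations generated by
`X^{(1)}, X^{(2)}, X^{(3)}` (6.1), and assume ii), iv), v) of §2.  Then*
`lim_{k↑∞} lim_{Λ↑ℤ^d} (N^{-2k} ⟨(O^{(1)})^{2k}⟩_Λ)^{1/(2k)} ≥ √3 lim_Λ (N⁻² ⟨(O^{(1)})²⟩_Λ)^{1/2}` (6.2).
KT's proof: Lemma 6.2 (the sphere averages `P_{l,m,n} = (k!/(l!m!n!)) G_k`,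
`G_k = (4π)⁻¹∫_{S²} x^{2k} dΩ = 1/(2k+1)`, `lim_k G_k^{1/(2k)} = 1`, (6.3)–(6.9)); Lemma 6.3 (reordering a
word of `2k` letters `O^{(i_j)}` costs `≤ #swaps · 2ō²N · (ōN)^{2k-2}`, by iv): `‖[O^{(i)}, O^{(j)}]‖ ≤ 2ō²N`,
(6.10)); then (6.11) `⟨((O)²)^k⟩ = Σ_{l+m+n=k} (k!/(l!m!n!)) ⟨(O^{(1)})^{2l}(O^{(2)})^{2m}(O^{(3)})^{2n}⟩ + O(N^{2k-1})`
with `(O)² = Σ_i (O^{(i)})²`, (6.12)–(6.13) averaging `⟨(xO^{(1)} + yO^{(2)} + zO^{(3)})^{2k}⟩ = ⟨(O^{(1)})^{2k}⟩`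
over the unit sphere by the finite rotations `U_Λ(x,y,z)` and the invariance (6.1), giving
`⟨(O^{(1)})^{2k}⟩ ≥ G_k ⟨((O)²)^k⟩ - O(N^{2k-1}) ≥ G_k (3⟨(O^{(1)})²⟩)^k - O(N^{2k-1})` (Hölder), i.e.
(6.14); `N ↑ ∞` then `k ↑ ∞` gives (6.2).  **Corollary 2.2** (p. 197) = Theorem 2.1 + Theorem 6.1
applied to the symmetric Gibbs states `⟨·⟩_Λ(0)` (invariant by vi) `[H_Λ, X^{(j)}] = 0`).

Rendering.  As in the tree's ground-state version of the same step (`KomaTasaki.SU2Datum.stepS`,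
`SU2Datum.re_inner_orderSq_pow_ge` in `KomaTasakiSSBOrderParameter.lean`, vector states with
`X Φ = 0`), the sphere average is performed INFINITESIMALLY and one factor `(O)²` at a time, now for
a linear functional `ω` with `ω(X A) = ω(A X)` (the infinitesimal form of (6.1); for the Gibbs state
it is cyclicity of the trace plus vi)): `(O)²` commutes with the generators, so for `W = ((O)²)^j`
and any word `S`, `ω(W [X, S]) = 0`; with `S = O^{(b)} (O^{(1)})^{2K-1}` and v) this is
`ω(W (O^{(1)})^{2K}) = Σ_p ω(W O^{(b)} (O^{(1)})^p O^{(b)} (O^{(1)})^{2K-2-p})`, i.e.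
`(2K-1) ω(W (O^{(b)})² (O^{(1)})^{2K-2}) = ω(W (O^{(1)})^{2K}) + O(N^{-1}·)` after reordering
(Lemma 6.3); peeling `((O)²)^k` `k` times telescopes `Π_K (2K+1)/(2K-1) = 2k+1 = 1/G_k`:
`Re ω(((O)²)^k) ≤ (2k+1) Re ω((O^{(1)})^{2k}) + 16k³3^k ō^{2k} N^{2k-1}` (`re_map_totSq_pow_le`, the
algebraic core of Theorem 6.1 for an arbitrary bounded invariant functional), while Jensen in the
Gibbs state (`pow_re_gibbsState_le_re_gibbsState_pow`, KT "Hölder") and `ω((O^{(b)})²) = ω((O^{(1)})²)`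
(the `k = 1` identity) give `Re ω(((O)²)^k) ≥ (3 Re ω((O^{(1)})²))^k`.  Result, the explicit-constant
finite-volume form of (6.14) for Gibbs states (`SU2System.kt93_theorem_6_1_fin`):
`3^k (N⁻²⟨(O^{(1)})²⟩)^k ≤ (2k+1) N^{-2k}⟨(O^{(1)})^{2k}⟩ + 16k³3^kō^{2k}/N`.  With
`kt93_theorem_2_1_holds` at a large fixed `k` (`(2k+1)^{1/(2k)} → 1`, here by Bernoulli's inequality)
and `N → ∞` this is (2.18) in the form typed by `kt93_corollary_2_2` (`kt93_corollary_2_2_holds`).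
No sphere integral, Haar measure or exponential map is needed; of KT's hypotheses only ii), iv),
v) for `j = 1, 2` (KT's `X^{(1)}, X^{(2)}` are `X 0, X 1, X 2` here with `O^{(1)} = Σ_x o 0 x`) and vi)
enter, exactly as printed ("we have actually made use of the `SO(3)` invariance").

## The `SO(2) = U(1)` case (KT93 Remark after Theorem 6.1): factor `√2`

KT93, Remark after Theorem 6.1 (p. 208): "Theorem 6.1 can easily be extended to systems with symmetry
other than `SU(2)`.  When a system has an `SO(n)` invariance, one gets a bound similar to (6.2) with the
factor `√3` replaced with `√n` … The most important of these extensions are the models with an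
`SO(2) = U(1)` invariance, where we get a factor `√2`.  Such models can be found in quantum
antiferromagnets with an XY-like anisotropy, or the electron pair condensation problems in lattice
electron systems."  The last section PROVES this extension and its combination with Theorem 2.1 (the
`U(1)` twin of Corollary 2.2, `m_s ≥ √2 σ`), over a `Z2System` (`O^{(1)} = O_Λ`) plus a second
Hermitian component `O^{(2)}` and ONE conserved generator `C` rotating `(O^{(1)}, O^{(2)})` (for pairing:
`C = N̂`, `O^{(1)} = Σ(Δ + Δ†)`, `O^{(2)} = Σ i(Δ - Δ†)`, `ε = -2i`): `re_map_sqSum_pow_le` (algebraic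
core, one generator, peeling factor `Π(2K+2)/(2K+1) = 1/G_k^{U(1)} ≤ 2k+1`; the state-form twin of the
tree's `U1System.stepQ`), `Z2System.kt93_theorem_6_1_u1_fin`
(`2^k (N⁻²⟨(O^{(1)})²⟩)^k ≤ (2k+1) N^{-2k}⟨(O^{(1)})^{2k}⟩ + 4κk³2^kō^{2k}/N`),
`Z2System.sqrt_mul_sqrt_moment_le_of_chain` (the common limit step) and `Z2System.kt93_corollary_2_2_u1`.
The commutator input is taken ABSTRACTLY as `‖[O^{(2)}, O^{(1)}]‖ ≤ κ ō² N`: KT's iv) gives `κ = 2`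
(Lemma 6.3); order-operator densities living on overlapping bonds (the d-wave pair field of the lattice
electron problem) are not covered by iv) as printed but satisfy the bound with `κ = 2 × (overlap
number)`, and only the bound enters the proof — cf. the tree's `KomaTasaki.U1OverlapSystem` for the same
point in the ground-state (KT94) setting.

Tree/Mathlib used: `kt93_theorem_2_1_holds`, `norm_comm_pow_le` (`KomaTasakiGriffithsTheoremProofs`),
`pow_re_gibbsState_le_re_gibbsState_pow`, `Z2System.moment_nonneg/abs_magnetisation_le`
(`KomaTasakiGriffithsTheorem`), `norm_gibbsState_le` (`ApproximatingHamiltonianProofs`),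
`Matrix.gibbsState_apply`, `Commute.exp_right`, the `ℓ²` operator norm API, `one_add_mul_le_pow`
(Bernoulli), `Real.rpow_add_le_add_rpow`, `Real.pow_rpow_inv_natCast`.  No new definitions, no named
facts.
-/

noncomputable section

open scoped Matrix.Norms.L2Operator ComplexOrder Topology
open Matrix Filter Finset

namespace Literature.MathematicalPhysics.QuantumLattice.KomaTasaki

/-! ### Ring identities and the infinitesimal rotation identity for an invariant functional -/

section GenericRing

variable {R : Type*} [Ring R]

/-- `[G, A^m] = Σ_{p<m} A^p [G, A] A^{m-1-p}`. [folklore] -/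
private theorem comm_pow_eq_sum_range (G A : R) (m : ℕ) :
    G * A ^ m - A ^ m * G = ∑ p ∈ range m, A ^ p * (G * A - A * G) * A ^ (m - 1 - p) := by
  induction m with
  | zero => simp
  | succ m ih =>
    have hsplit : G * A ^ (m + 1) - A ^ (m + 1) * G =
        (G * A ^ m - A ^ m * G) * A + A ^ m * (G * A - A * G) := by
      rw [pow_succ]; noncomm_ring
    rw [hsplit, ih, sum_range_succ, Finset.sum_mul]
    congr 1
    · refine Finset.sum_congr rfl fun p hp => ?_
      rw [mem_range] at hp
      rw [mul_assoc, ← pow_succ, show m - 1 - p + 1 = m + 1 - 1 - p by omega]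
    · rw [show m + 1 - 1 - m = 0 by omega, pow_zero, mul_one]

/-- Commutator of a generator `G` with the word `B A^m` when `[G, B] = ε A`, `[G, A] = -ε B`:
`[G, B A^m] = ε (A^{m+1} - Σ_{p<m} B A^p B A^{m-1-p})`. [folklore] -/
private theorem comm_mul_pow_eq_smul [Algebra ℂ R] (G A B : R) (ε : ℂ)
    (hB : G * B - B * G = ε • A) (hA : G * A - A * G = -(ε • B)) (m : ℕ) :
    G * (B * A ^ m) - B * A ^ m * G =
      ε • (A ^ (m + 1) - ∑ p ∈ range m, B * A ^ p * B * A ^ (m - 1 - p)) := by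
  have h1 : G * (B * A ^ m) - B * A ^ m * G =
      (G * B - B * G) * A ^ m + B * (G * A ^ m - A ^ m * G) := by noncomm_ring
  rw [h1, hB, comm_pow_eq_sum_range, hA, smul_sub, pow_succ', smul_mul_assoc, Finset.mul_sum,
    Finset.smul_sum, sub_eq_add_neg, ← Finset.sum_neg_distrib]
  congr 1
  refine Finset.sum_congr rfl fun p _ => ?_
  simp only [mul_neg, neg_mul, mul_smul_comm, smul_mul_assoc, mul_assoc]

/-- `[G, A² + B²] = 0` when `G A = A G + ε B` and `G B = B G - ε A`. [folklore] -/
private theorem commute_sq_add_sq_of [Algebra ℂ R] (G A B : R) (ε : ℂ)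
    (hA : G * A = A * G + ε • B) (hB : G * B = B * G - ε • A) :
    Commute G (A * A + B * B) := by
  show G * (A * A + B * B) = (A * A + B * B) * G
  calc G * (A * A + B * B) = (G * A) * A + (G * B) * B := by noncomm_ring
    _ = (A * G + ε • B) * A + (B * G - ε • A) * B := by rw [hA, hB]
    _ = A * (G * A) + B * (G * B) + ε • (B * A) - ε • (A * B) := by
        simp only [add_mul, sub_mul, smul_mul_assoc, mul_assoc]; abel
    _ = A * (A * G + ε • B) + B * (B * G - ε • A) + ε • (B * A) - ε • (A * B) := by rw [hA, hB]
    _ = (A * A + B * B) * G := by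
        simp only [mul_add, mul_sub, mul_smul_comm, mul_assoc, add_mul]; abel

/-- **Infinitesimal invariance kills commutators**: if the linear functional `ω` satisfies
`ω(G A) = ω(A G)` for all `A` (invariance under the one-parameter group generated by `G`, in
infinitesimal form) and `G` commutes with `W`, then `ω(W [G, S]) = 0` for every `S`.  (For a vector
state with `G Φ = 0` this is the tree's `inner_mul_comm_eq_zero` step of `SU2Datum.stepS`.)
[cite: KomaTasaki1993, Theorem 6.1, (6.1) and (6.12)–(6.13) (invariance of the state)] -/
private theorem map_mul_comm_eq_zero [Algebra ℂ R] (ω : R →ₗ[ℂ] ℂ) (G W S : R)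
    (hinv : ∀ A, ω (G * A) = ω (A * G)) (hW : Commute G W) :
    ω (W * (G * S - S * G)) = 0 := by
  have h1 : W * (G * S - S * G) = G * (W * S) - (W * S) * G := by
    rw [mul_sub, ← mul_assoc, ← hW.eq]; noncomm_ring
  rw [h1, map_sub, hinv, sub_self]

/-- **The rotation identity behind KT93 (6.12)–(6.13) in infinitesimal form, for a functional**:
with `ω`, `G`, `W` as in `map_mul_comm_eq_zero` and `[G, B] = ε A`, `[G, A] = -ε B`, `ε ≠ 0`,
`ω(W A^{m+1}) = Σ_{p<m} ω(W B A^p B A^{m-1-p})`.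
[cite: KomaTasaki1993, Theorem 6.1, (6.12)–(6.13)] -/
private theorem map_mul_pow_eq_sum [Algebra ℂ R] (ω : R →ₗ[ℂ] ℂ) (G W A B : R) {ε : ℂ}
    (hinv : ∀ S, ω (G * S) = ω (S * G)) (hW : Commute G W)
    (hB : G * B - B * G = ε • A) (hA : G * A - A * G = -(ε • B)) (hε : ε ≠ 0) (m : ℕ) :
    ω (W * A ^ (m + 1)) = ∑ p ∈ range m, ω (W * (B * A ^ p * B * A ^ (m - 1 - p))) := by
  have h0 := map_mul_comm_eq_zero ω G W (B * A ^ m) hinv hW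
  rw [comm_mul_pow_eq_smul G A B ε hB hA m, mul_smul_comm, map_smul, smul_eq_mul,
    mul_eq_zero] at h0
  have h1 := h0.resolve_left hε
  rw [mul_sub, map_sub, sub_eq_zero, Finset.mul_sum, map_sum] at h1
  exact h1

end GenericRing

/-! ### `ℓ²` operator-norm bookkeeping (KT93 Lemma 6.3: reordering costs) -/

section GenericMatrix

variable {n : Type*} [Fintype n] [DecidableEq n]

/-- `‖1‖ ≤ 1` for the `ℓ²` operator norm. [folklore] -/
private theorem l2_opNorm_one_le_one : ‖(1 : Matrix n n ℂ)‖ ≤ 1 := by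
  rw [← l2_opNorm_toEuclideanCLM, map_one, ContinuousLinearMap.one_def]
  exact ContinuousLinearMap.norm_id_le

/-- `‖X ^ j‖ ≤ A ^ j` if `‖X‖ ≤ A`. [folklore] -/
private theorem l2_opNorm_pow_le {X : Matrix n n ℂ} {A : ℝ} (hX : ‖X‖ ≤ A) (j : ℕ) :
    ‖X ^ j‖ ≤ A ^ j := by
  have hA : 0 ≤ A := (norm_nonneg _).trans hX
  induction j with
  | zero => simpa using l2_opNorm_one_le_one
  | succ j ih =>
    rw [pow_succ, pow_succ]
    exact (l2_opNorm_mul _ _).trans (mul_le_mul ih hX (norm_nonneg _) (pow_nonneg hA _))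

/-- `‖[A, B]‖ ≤ 2 ‖A‖ ‖B‖`. [folklore] -/
private theorem l2_opNorm_comm_le (A B : Matrix n n ℂ) : ‖A * B - B * A‖ ≤ 2 * ‖A‖ * ‖B‖ :=
  calc ‖A * B - B * A‖ ≤ ‖A * B‖ + ‖B * A‖ := norm_sub_le _ _
    _ ≤ ‖A‖ * ‖B‖ + ‖B‖ * ‖A‖ := add_le_add (l2_opNorm_mul _ _) (l2_opNorm_mul _ _)
    _ = 2 * ‖A‖ * ‖B‖ := by ring

omit [DecidableEq n] in
/-- The commutator of two sums over the same sites whose off-diagonal terms commute is the sum of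
the on-site commutators: `[Σ_x A_x, Σ_x B_x] = Σ_x [A_x, B_x]` (KT93 hypothesis iv) ⟹ Lemma 6.3).
[folklore] -/
private theorem sum_mul_sum_sub_eq_sum {ι : Type*} [Fintype ι] (A B : ι → Matrix n n ℂ)
    (h : ∀ i j, i ≠ j → A i * B j = B j * A i) :
    (∑ i, A i) * (∑ i, B i) - (∑ i, B i) * (∑ i, A i) = ∑ i, (A i * B i - B i * A i) := by
  have h2 : (∑ i, B i) * (∑ i, A i) = ∑ i, ∑ j, B j * A i := by
    rw [Finset.sum_mul_sum, Finset.sum_comm]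
  rw [Finset.sum_mul_sum, h2, ← Finset.sum_sub_distrib]
  refine Finset.sum_congr rfl fun i _ => ?_
  rw [← Finset.sum_sub_distrib]
  exact Finset.sum_eq_single i (fun j _ hji => sub_eq_zero.mpr (h i j (Ne.symm hji))) (by simp)

/-- For a functional bounded by the operator norm, `|Re ω(X) - Re ω(Y)| ≤ ‖X - Y‖`. [folklore] -/
private theorem abs_re_map_sub_le (ω : Matrix n n ℂ →ₗ[ℂ] ℂ) (hω : ∀ A, ‖ω A‖ ≤ ‖A‖)
    (X Y : Matrix n n ℂ) : |(ω X).re - (ω Y).re| ≤ ‖X - Y‖ := by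
  rw [← Complex.sub_re, ← map_sub]
  exact (Complex.abs_re_le_norm _).trans (hω _)

/-- **Reordering one letter** (KT93 Lemma 6.3, one swap chain): `‖W B A^p B A^q - W B² A^{p+q}‖ ≤
‖W‖ p c β^{p+q+1}` when `‖A‖, ‖B‖ ≤ β` and `‖B A - A B‖ ≤ c β`.
[cite: KomaTasaki1993, Lemma 6.3 (6.10)] -/
private theorem norm_word_sub_le_mat (W A B : Matrix n n ℂ) {β c : ℝ} (hβ : 0 ≤ β) (hc : 0 ≤ c)
    (hA : ‖A‖ ≤ β) (hB : ‖B‖ ≤ β) (hBA : ‖B * A - A * B‖ ≤ c * β) (p q : ℕ) :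
    ‖W * (B * A ^ p * B * A ^ q) - W * (B * B * A ^ (p + q))‖ ≤ ‖W‖ * (p * c * β ^ (p + q + 1)) := by
  have h1 : W * (B * A ^ p * B * A ^ q) - W * (B * B * A ^ (p + q)) =
      W * (B * (A ^ p * B - B * A ^ p) * A ^ q) := by
    rw [pow_add]; noncomm_ring
  have h2 : ‖A ^ p * B - B * A ^ p‖ ≤ p * c * β ^ p := by
    rw [← norm_neg, neg_sub]
    exact norm_comm_pow_le hc hA hBA p
  have h3 : ‖A ^ q‖ ≤ β ^ q := l2_opNorm_pow_le hA q
  have h4 : (0 : ℝ) ≤ p * c * β ^ p := mul_nonneg (mul_nonneg (Nat.cast_nonneg _) hc) (pow_nonneg hβ _)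
  rw [h1]
  calc ‖W * (B * (A ^ p * B - B * A ^ p) * A ^ q)‖
      ≤ ‖W‖ * (‖B‖ * ‖A ^ p * B - B * A ^ p‖ * ‖A ^ q‖) := by
        refine (l2_opNorm_mul _ _).trans ?_
        gcongr
        exact (l2_opNorm_mul _ _).trans
          (mul_le_mul_of_nonneg_right (l2_opNorm_mul _ _) (norm_nonneg _))
    _ ≤ ‖W‖ * (β * (p * c * β ^ p) * β ^ q) :=
        mul_le_mul_of_nonneg_left
          (mul_le_mul (mul_le_mul hB h2 (norm_nonneg _) hβ) h3 (norm_nonneg _)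
            (mul_nonneg hβ h4)) (norm_nonneg W)
    _ = ‖W‖ * (p * c * β ^ (p + q + 1)) := by ring

/-- **The averaged reordering estimate behind KT93 (6.13), infinitesimal form, for a functional**:
with `ω(G S) = ω(S G)`, `‖ω A‖ ≤ ‖A‖`, `[G, W] = 0`, `[G, B] = ε A`, `[G, A] = -ε B` (`ε ≠ 0`),
`‖A‖, ‖B‖ ≤ β`, `‖[B, A]‖ ≤ c β`, `‖W‖ ≤ w`:
`|Re ω(W A^{m+1}) - m Re ω(W B² A^{m-1})| ≤ w m² c β^m`.
[cite: KomaTasaki1993, Theorem 6.1 (6.13), Lemma 6.3 (6.10)] -/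
private theorem rot_estimate_map (ω : Matrix n n ℂ →ₗ[ℂ] ℂ) (hω : ∀ A, ‖ω A‖ ≤ ‖A‖)
    (G W A B : Matrix n n ℂ) {ε : ℂ} {β c w : ℝ}
    (hinv : ∀ S, ω (G * S) = ω (S * G)) (hW : Commute G W)
    (hB : G * B - B * G = ε • A) (hA : G * A - A * G = -(ε • B)) (hε : ε ≠ 0)
    (hβ : 0 ≤ β) (hc : 0 ≤ c) (hA' : ‖A‖ ≤ β) (hB' : ‖B‖ ≤ β)
    (hBA : ‖B * A - A * B‖ ≤ c * β) (hWn : ‖W‖ ≤ w) (m : ℕ) :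
    |(ω (W * A ^ (m + 1))).re - m * (ω (W * (B * B * A ^ (m - 1)))).re|
      ≤ w * (m ^ 2 * c * β ^ m) := by
  rw [map_mul_pow_eq_sum ω G W A B hinv hW hB hA hε m, Complex.re_sum]
  have hm : (m : ℝ) * (ω (W * (B * B * A ^ (m - 1)))).re
      = ∑ _p ∈ range m, (ω (W * (B * B * A ^ (m - 1)))).re := by
    rw [Finset.sum_const, card_range, nsmul_eq_mul]
  rw [hm, ← Finset.sum_sub_distrib]
  refine (Finset.abs_sum_le_sum_abs _ _).trans ?_
  have hw : 0 ≤ w := (norm_nonneg _).trans hWn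
  calc ∑ p ∈ range m, |(ω (W * (B * A ^ p * B * A ^ (m - 1 - p)))).re
          - (ω (W * (B * B * A ^ (m - 1)))).re|
      ≤ ∑ p ∈ range m, ‖W‖ * (p * c * β ^ m) := by
        refine Finset.sum_le_sum fun p hp => ?_
        rw [mem_range] at hp
        have h := norm_word_sub_le_mat W A B hβ hc hA' hB' hBA p (m - 1 - p)
        rw [show p + (m - 1 - p) = m - 1 by omega, show m - 1 + 1 = m by omega] at h
        exact (abs_re_map_sub_le ω hω _ _).trans h
    _ ≤ ∑ _p ∈ range m, w * (m * c * β ^ m) := by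
        refine Finset.sum_le_sum fun p hp => ?_
        rw [mem_range] at hp
        have hp' : (p : ℝ) ≤ m := by exact_mod_cast hp.le
        have h1 : ‖W‖ * (p * c * β ^ m) ≤ w * (p * c * β ^ m) :=
          mul_le_mul_of_nonneg_right hWn (by positivity)
        refine h1.trans ?_
        gcongr
    _ = w * (m ^ 2 * c * β ^ m) := by
        rw [Finset.sum_const, card_range, nsmul_eq_mul]; ring

/-- `ω((O^{(b)})²) = ω((O^{(1)})²)` for an invariant functional (the `k = 1` case of the rotation
average KT93 (6.13)): with `ω(G S) = ω(S G)`, `[G, B] = ε A`, `[G, A] = -ε B`, `ε ≠ 0`,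
`ω(B B) = ω(A A)`. [cite: KomaTasaki1993, Theorem 6.1 (6.13), `k = 1`] -/
private theorem map_sq_eq_map_sq {R : Type*} [Ring R] [Algebra ℂ R] (ω : R →ₗ[ℂ] ℂ) (G A B : R)
    {ε : ℂ} (hinv : ∀ S, ω (G * S) = ω (S * G))
    (hB : G * B - B * G = ε • A) (hA : G * A - A * G = -(ε • B)) (hε : ε ≠ 0) :
    ω (B * B) = ω (A * A) := by
  have h := map_mul_pow_eq_sum ω G 1 A B hinv (Commute.one_right G) hB hA hε 1
  simp only [sum_range_one, pow_zero, mul_one, one_mul, Nat.sub_self] at h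
  rw [← h, pow_succ, pow_one]

/-! ### KT93 Theorem 6.1, algebraic core for an invariant functional (rotation average) -/

/-- **KT93 Theorem 6.1, the rotation average in state form (algebraic core, explicit constants).**
Let `ω` be a linear functional on `Matrix n n ℂ` bounded by the operator norm (`‖ω A‖ ≤ ‖A‖`) and
invariant under two generators `X₁, X₂` in infinitesimal form, `ω(X A) = ω(A X)` (KT93 (6.1)); let
`O₀, O₁, O₂` ("`O^{(1)}, O^{(2)}, O^{(3)}`") be rotated as a vector by them (KT93 v) (2.16)):
`[X₂, O₀] = i O₁`, `[X₂, O₁] = -i O₀`, `[X₂, O₂] = 0`, `[X₁, O₀] = -i O₂`, `[X₁, O₂] = i O₀`,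
`[X₁, O₁] = 0`, with `‖O_i‖ ≤ R` (ii): `R = ōN`) and `‖[O_b, O₀]‖ ≤ c R` (iv) and Lemma 6.3:
`c = 2ō`).  Then for every `k`, with `(O)² = O₀² + O₁² + O₂²`,
`Re ω(((O)²)^{k+1}) ≤ (2k+3) Re ω(O₀^{2(k+1)}) + 2(k+1) · 3^{k+1} (2k+2)² c R^{2k+1}` — the
finite-volume content of (6.11)–(6.14) (`⟨((O)²)^k⟩ ≈ G_k⁻¹ ⟨(O^{(1)})^{2k}⟩`, `G_k⁻¹ = 2k+1`), obtained
by peeling one factor `(O)²` at a time (`(2K+1) ω(W (O₀)^{2K} (O)²) ≈ (2K+3) ω(W O₀^{2K+2})`, the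
infinitesimal form of the sphere average (6.12)–(6.13) — same statement, the technique of the tree's
`SU2Datum.stepS`).  The companion lower bound `Re ω(((O)²)^k) ≥ (3 Re ω(O₀²))^k` needs positivity of
`ω` (Jensen) and is supplied for Gibbs states in `SU2System.kt93_theorem_6_1_fin`.
[cite: KomaTasaki1993, Theorem 6.1 (6.11)–(6.14), Lemma 6.3 (6.10)] -/
theorem re_map_totSq_pow_le (ω : Matrix n n ℂ →ₗ[ℂ] ℂ) (hω : ∀ A, ‖ω A‖ ≤ ‖A‖)
    {O₀ O₁ O₂ X₁ X₂ : Matrix n n ℂ} {R c : ℝ} (hR : 0 ≤ R) (hc : 0 ≤ c)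
    (hX₁ : ∀ A, ω (X₁ * A) = ω (A * X₁)) (hX₂ : ∀ A, ω (X₂ * A) = ω (A * X₂))
    (h20 : X₂ * O₀ - O₀ * X₂ = Complex.I • O₁) (h21 : X₂ * O₁ - O₁ * X₂ = -(Complex.I • O₀))
    (h22 : Commute X₂ O₂)
    (h10 : X₁ * O₀ - O₀ * X₁ = -(Complex.I • O₂)) (h12 : X₁ * O₂ - O₂ * X₁ = Complex.I • O₀)
    (h11 : Commute X₁ O₁)
    (hO₀ : ‖O₀‖ ≤ R) (hO₁ : ‖O₁‖ ≤ R) (hO₂ : ‖O₂‖ ≤ R)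
    (hc₁ : ‖O₁ * O₀ - O₀ * O₁‖ ≤ c * R) (hc₂ : ‖O₂ * O₀ - O₀ * O₂‖ ≤ c * R) (k : ℕ) :
    (ω ((O₀ * O₀ + O₁ * O₁ + O₂ * O₂) ^ (k + 1))).re
      ≤ (2 * k + 3) * (ω (O₀ ^ (2 * (k + 1)))).re
        + 2 * (k + 1) * (3 ^ (k + 1) * ((2 * (k : ℝ) + 2) ^ 2 * c * R ^ (2 * k + 1))) := by
  set Q : Matrix n n ℂ := O₀ * O₀ + O₁ * O₁ + O₂ * O₂ with hQ_def
  -- `(O)²` commutes with both generators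
  have hQX₂ : Commute X₂ Q := by
    have hA : X₂ * O₀ = O₀ * X₂ + Complex.I • O₁ := sub_eq_iff_eq_add'.mp h20
    have hB : X₂ * O₁ = O₁ * X₂ - Complex.I • O₀ := by
      rw [sub_eq_add_neg]; exact sub_eq_iff_eq_add'.mp h21
    have h01 : Commute X₂ (O₀ * O₀ + O₁ * O₁) := commute_sq_add_sq_of X₂ O₀ O₁ Complex.I hA hB
    exact h01.add_right (h22.mul_right h22)
  have hQX₁ : Commute X₁ Q := by
    have hA : X₁ * O₂ = O₂ * X₁ + Complex.I • O₀ := sub_eq_iff_eq_add'.mp h12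
    have hB : X₁ * O₀ = O₀ * X₁ - Complex.I • O₂ := by
      rw [sub_eq_add_neg]; exact sub_eq_iff_eq_add'.mp h10
    have h20' : Commute X₁ (O₂ * O₂ + O₀ * O₀) := commute_sq_add_sq_of X₁ O₂ O₀ Complex.I hA hB
    have e : Q = (O₂ * O₂ + O₀ * O₀) + O₁ * O₁ := by rw [hQ_def]; abel
    rw [e]
    exact h20'.add_right (h11.mul_right h11)
  -- norm of `(O)²`
  have hQn : ‖Q‖ ≤ 3 * R ^ 2 := by
    calc ‖Q‖ ≤ ‖O₀ * O₀‖ + ‖O₁ * O₁‖ + ‖O₂ * O₂‖ := norm_add₃_le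
      _ ≤ ‖O₀‖ * ‖O₀‖ + ‖O₁‖ * ‖O₁‖ + ‖O₂‖ * ‖O₂‖ :=
          add_le_add (add_le_add (l2_opNorm_mul _ _) (l2_opNorm_mul _ _)) (l2_opNorm_mul _ _)
      _ ≤ R * R + R * R + R * R := by gcongr
      _ = 3 * R ^ 2 := by ring
  have h3R : 0 ≤ 3 * R ^ 2 := by positivity
  -- one peeling step: `(2K+1) Re ω(Q^{j+1} O₀^{2K}) ≤ (2K+3) Re ω(Q^j O₀^{2K+2}) + 2 (3R²)^j (2K+1)² c R^{2K+1}`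
  have stepS : ∀ j K : ℕ,
      (2 * K + 1) * (ω (Q ^ (j + 1) * O₀ ^ (2 * K))).re
        ≤ (2 * K + 3) * (ω (Q ^ j * O₀ ^ (2 * K + 2))).re
          + 2 * ((3 * R ^ 2) ^ j * ((2 * (K : ℝ) + 1) ^ 2 * c * R ^ (2 * K + 1))) := by
    intro j K
    have hsplit : Q ^ (j + 1) * O₀ ^ (2 * K) =
        Q ^ j * O₀ ^ (2 * K + 2) + Q ^ j * (O₁ * O₁ * O₀ ^ (2 * K))
          + Q ^ j * (O₂ * O₂ * O₀ ^ (2 * K)) := by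
      have hsq : O₀ * O₀ * O₀ ^ (2 * K) = O₀ ^ (2 * K + 2) := by
        rw [pow_succ', pow_succ', mul_assoc]
      rw [pow_succ, mul_assoc, hQ_def, add_mul, add_mul, hsq, mul_add, mul_add]
    have hW₂ : Commute X₂ (Q ^ j) := hQX₂.pow_right j
    have hW₁ : Commute X₁ (Q ^ j) := hQX₁.pow_right j
    have hWn : ‖Q ^ j‖ ≤ (3 * R ^ 2) ^ j := l2_opNorm_pow_le hQn j
    -- `X₂` rotates `(O₀, O₁)`: `[X₂, O₁] = (-i) O₀`, `[X₂, O₀] = -((-i) O₁)`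
    have hB₂ : X₂ * O₁ - O₁ * X₂ = (-Complex.I) • O₀ := by rw [h21, neg_smul]
    have hA₂ : X₂ * O₀ - O₀ * X₂ = -((-Complex.I) • O₁) := by rw [h20, neg_smul, neg_neg]
    have hε₂ : (-Complex.I : ℂ) ≠ 0 := neg_ne_zero.mpr Complex.I_ne_zero
    have h2 := rot_estimate_map ω hω X₂ (Q ^ j) O₀ O₁ hX₂ hW₂ hB₂ hA₂ hε₂ hR hc hO₀ hO₁ hc₁ hWn
      (2 * K + 1)
    -- `X₁` rotates `(O₂, O₀)`: `[X₁, O₂] = i O₀`, `[X₁, O₀] = -(i O₂)`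
    have h3 := rot_estimate_map ω hω X₁ (Q ^ j) O₀ O₂ hX₁ hW₁ h12 h10 Complex.I_ne_zero hR hc hO₀
      hO₂ hc₂ hWn (2 * K + 1)
    rw [show 2 * K + 1 - 1 = 2 * K by omega, show 2 * K + 1 + 1 = 2 * K + 2 by omega] at h2 h3
    rw [hsplit, map_add, map_add, Complex.add_re, Complex.add_re]
    push_cast at h2 h3 ⊢
    obtain ⟨h2a, h2b⟩ := abs_le.mp h2
    obtain ⟨h3a, h3b⟩ := abs_le.mp h3
    nlinarith [h2a, h2b, h3a, h3b]
  -- uniform bound for the peeling errors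
  have peel : ∀ K : ℕ, K ≤ k →
      (3 * R ^ 2) ^ (k - K) * ((2 * (K : ℝ) + 1) ^ 2 * c * R ^ (2 * K + 1))
        ≤ 3 ^ (k + 1) * ((2 * (k : ℝ) + 2) ^ 2 * c * R ^ (2 * k + 1)) := by
    intro K hK
    have e : (3 * R ^ 2) ^ (k - K) * ((2 * (K : ℝ) + 1) ^ 2 * c * R ^ (2 * K + 1))
        = 3 ^ (k - K) * ((2 * (K : ℝ) + 1) ^ 2 * c * R ^ (2 * k + 1)) := by
      rw [mul_pow, ← pow_mul, show R ^ (2 * k + 1) = R ^ (2 * (k - K)) * R ^ (2 * K + 1) by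
        rw [← pow_add]; congr 1; omega]
      ring
    rw [e]
    have h1 : (3 : ℝ) ^ (k - K) ≤ 3 ^ (k + 1) := pow_le_pow_right₀ (by norm_num) (by omega)
    have h2 : (2 * (K : ℝ) + 1) ^ 2 ≤ (2 * (k : ℝ) + 2) ^ 2 := by
      have : (K : ℝ) ≤ k := by exact_mod_cast hK
      nlinarith
    have h0 : 0 ≤ (3 : ℝ) ^ (k - K) := pow_nonneg (by norm_num) _
    gcongr
  -- the chain `Re ω(Q^{k+1}) - 2K e ≤ (2K+1) Re ω(Q^{k+1-K} O₀^{2K})`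
  set e : ℝ := 3 ^ (k + 1) * ((2 * (k : ℝ) + 2) ^ 2 * c * R ^ (2 * k + 1)) with he_def
  have keyS : ∀ K, K ≤ k + 1 →
      (ω (Q ^ (k + 1) * O₀ ^ (2 * 0))).re - 2 * K * e
        ≤ (2 * K + 1) * (ω (Q ^ (k + 1 - K) * O₀ ^ (2 * K))).re := by
    intro K
    induction K with
    | zero => intro _; simp
    | succ K ih =>
      intro hK
      have ih' := ih (by omega)
      have hs := stepS (k - K) K
      have hp := peel K (by omega)
      rw [show k - K + 1 = k + 1 - K by omega] at hs
      rw [show k + 1 - (K + 1) = k - K by omega, show 2 * (K + 1) = 2 * K + 2 by ring]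
      push_cast at hs ih' ⊢
      nlinarith [hs, ih', hp]
  have hS := keyS (k + 1) le_rfl
  rw [Nat.sub_self, Nat.mul_zero, pow_zero, pow_zero, mul_one, one_mul] at hS
  push_cast at hS
  linarith

end GenericMatrix

/-! ### KT93 Corollary 2.2: the `SU(2)` data instantiated, Theorem 6.1 for Gibbs states -/

section SU2

universe v

variable {N : ℕ} {hb ob : ℝ} {r : ℕ} {n : Type v} [Fintype n] [DecidableEq n]

omit [Fintype n] [DecidableEq n] in
/-- `Σ_l ε_{31l} O^{(l)} = O^{(2)}` (indices `2 0 ↦ 1`). [cite: KomaTasaki1993, after (2.15)] -/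
private theorem sum_leviCivita_two_zero (O : Fin 3 → Matrix n n ℂ) :
    ∑ l, (leviCivita 2 0 l : ℂ) • O l = O 1 := by
  have h0 : leviCivita 2 0 0 = 0 := by decide
  have h1 : leviCivita 2 0 1 = 1 := by decide
  have h2 : leviCivita 2 0 2 = 0 := by decide
  simp only [Fin.sum_univ_three, h0, h1, h2, Int.cast_zero, Int.cast_one, zero_smul, one_smul,
    zero_add, add_zero]

omit [Fintype n] [DecidableEq n] in
/-- `Σ_l ε_{32l} O^{(l)} = -O^{(1)}` (indices `2 1 ↦ 0`). [cite: KomaTasaki1993, after (2.15)] -/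
private theorem sum_leviCivita_two_one (O : Fin 3 → Matrix n n ℂ) :
    ∑ l, (leviCivita 2 1 l : ℂ) • O l = -O 0 := by
  have h0 : leviCivita 2 1 0 = -1 := by decide
  have h1 : leviCivita 2 1 1 = 0 := by decide
  have h2 : leviCivita 2 1 2 = 0 := by decide
  simp only [Fin.sum_univ_three, h0, h1, h2, Int.cast_zero, Int.cast_one, Int.cast_neg, zero_smul,
    neg_smul, one_smul, add_zero]

omit [Fintype n] [DecidableEq n] in
/-- `Σ_l ε_{33l} O^{(l)} = 0`. [cite: KomaTasaki1993, after (2.15)] -/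
private theorem sum_leviCivita_two_two (O : Fin 3 → Matrix n n ℂ) :
    ∑ l, (leviCivita 2 2 l : ℂ) • O l = 0 := by
  have h : ∀ l, leviCivita 2 2 l = 0 := fun l => (leviCivita_values.2.2.2.2.2.2) 2 l
  simp [h]

omit [Fintype n] [DecidableEq n] in
/-- `Σ_l ε_{21l} O^{(l)} = -O^{(3)}` (indices `1 0 ↦ 2`). [cite: KomaTasaki1993, after (2.15)] -/
private theorem sum_leviCivita_one_zero (O : Fin 3 → Matrix n n ℂ) :
    ∑ l, (leviCivita 1 0 l : ℂ) • O l = -O 2 := by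
  have h0 : leviCivita 1 0 0 = 0 := by decide
  have h1 : leviCivita 1 0 1 = 0 := by decide
  have h2 : leviCivita 1 0 2 = -1 := by decide
  simp only [Fin.sum_univ_three, h0, h1, h2, Int.cast_zero, Int.cast_one, Int.cast_neg, zero_smul,
    neg_smul, one_smul, zero_add]

omit [Fintype n] [DecidableEq n] in
/-- `Σ_l ε_{23l} O^{(l)} = O^{(1)}` (indices `1 2 ↦ 0`). [cite: KomaTasaki1993, after (2.15)] -/
private theorem sum_leviCivita_one_two (O : Fin 3 → Matrix n n ℂ) :
    ∑ l, (leviCivita 1 2 l : ℂ) • O l = O 0 := by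
  have h0 : leviCivita 1 2 0 = 1 := by decide
  have h1 : leviCivita 1 2 1 = 0 := by decide
  have h2 : leviCivita 1 2 2 = 0 := by decide
  simp only [Fin.sum_univ_three, h0, h1, h2, Int.cast_zero, Int.cast_one, zero_smul, one_smul,
    add_zero]

omit [Fintype n] [DecidableEq n] in
/-- `Σ_l ε_{22l} O^{(l)} = 0`. [cite: KomaTasaki1993, after (2.15)] -/
private theorem sum_leviCivita_one_one (O : Fin 3 → Matrix n n ℂ) :
    ∑ l, (leviCivita 1 1 l : ℂ) • O l = 0 := by
  have h : ∀ l, leviCivita 1 1 l = 0 := fun l => (leviCivita_values.2.2.2.2.2.2) 1 l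
  simp [h]

namespace SU2System

variable (S : SU2System N hb ob r n)

/-- v) (2.16) for `X^{(3)}`, `O^{(1)}`: `[X₂, O₀] = i O₁`. [cite: KomaTasaki1993, (2.16)] -/
theorem X_two_order_zero :
    S.X 2 * (∑ x, S.o 0 x) - (∑ x, S.o 0 x) * S.X 2 = Complex.I • ∑ x, S.o 1 x := by
  rw [S.X_order 2 0, sum_leviCivita_two_zero]

/-- v) (2.16) for `X^{(3)}`, `O^{(2)}`: `[X₂, O₁] = -i O₀`. [cite: KomaTasaki1993, (2.16)] -/
theorem X_two_order_one :
    S.X 2 * (∑ x, S.o 1 x) - (∑ x, S.o 1 x) * S.X 2 = -(Complex.I • ∑ x, S.o 0 x) := by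
  rw [S.X_order 2 1, sum_leviCivita_two_one, smul_neg]

/-- v) (2.16) for `X^{(3)}`, `O^{(3)}`: `[X₂, O₂] = 0`. [cite: KomaTasaki1993, (2.16)] -/
theorem commute_X_two_order_two : Commute (S.X 2) (∑ x, S.o 2 x) := by
  have h := S.X_order 2 2
  rw [sum_leviCivita_two_two, smul_zero, sub_eq_zero] at h
  exact h

/-- v) (2.16) for `X^{(2)}`, `O^{(1)}`: `[X₁, O₀] = -i O₂`. [cite: KomaTasaki1993, (2.16)] -/
theorem X_one_order_zero :
    S.X 1 * (∑ x, S.o 0 x) - (∑ x, S.o 0 x) * S.X 1 = -(Complex.I • ∑ x, S.o 2 x) := by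
  rw [S.X_order 1 0, sum_leviCivita_one_zero, smul_neg]

/-- v) (2.16) for `X^{(2)}`, `O^{(3)}`: `[X₁, O₂] = i O₀`. [cite: KomaTasaki1993, (2.16)] -/
theorem X_one_order_two :
    S.X 1 * (∑ x, S.o 2 x) - (∑ x, S.o 2 x) * S.X 1 = Complex.I • ∑ x, S.o 0 x := by
  rw [S.X_order 1 2, sum_leviCivita_one_two]

/-- v) (2.16) for `X^{(2)}`, `O^{(2)}`: `[X₁, O₁] = 0`. [cite: KomaTasaki1993, (2.16)] -/
theorem commute_X_one_order_one : Commute (S.X 1) (∑ x, S.o 1 x) := by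
  have h := S.X_order 1 1
  rw [sum_leviCivita_one_one, smul_zero, sub_eq_zero] at h
  exact h

/-- ii) summed: `‖O^{(i)}_Λ‖ ≤ ō N`. [cite: KomaTasaki1993, hypothesis ii)] -/
theorem norm_orderComp_le (i : Fin 3) : ‖∑ x, S.o i x‖ ≤ ob * N :=
  calc ‖∑ x, S.o i x‖ ≤ ∑ x, ‖S.o i x‖ := norm_sum_le _ _
    _ ≤ ∑ _x : Fin N, ob := sum_le_sum fun x _ => S.norm_o_le i x
    _ = ob * N := by rw [sum_const, card_univ, Fintype.card_fin, nsmul_eq_mul]; ring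

include S in
/-- `ō ≥ 0` as soon as there is a site. [cite: KomaTasaki1993, hypothesis ii)] -/
theorem ob_nonneg (hN : 1 ≤ N) : 0 ≤ ob := (norm_nonneg _).trans (S.norm_o_le 0 ⟨0, hN⟩)

/-- **KT93 Lemma 6.3, the commutator input**: by iv) `[O^{(i)}, O^{(i')}] = Σ_x [o^{(i)}_x, o^{(i')}_x]`,
hence `‖[O^{(i)}_Λ, O^{(i')}_Λ]‖ ≤ 2ō²N` ("the bound `‖[O^{(i)}, O^{(j)}]‖ ≤ 2ō²N`").
[cite: KomaTasaki1993, Lemma 6.3 (proof), hypothesis iv)] -/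
theorem norm_comm_orderComp_le (i i' : Fin 3) :
    ‖(∑ x, S.o i x) * (∑ x, S.o i' x) - (∑ x, S.o i' x) * (∑ x, S.o i x)‖ ≤ 2 * ob ^ 2 * N := by
  rw [sum_mul_sum_sub_eq_sum (S.o i) (S.o i') (fun x y hxy => (S.commute_o_o i i' x y hxy).eq)]
  calc ‖∑ x, (S.o i x * S.o i' x - S.o i' x * S.o i x)‖
      ≤ ∑ x, ‖S.o i x * S.o i' x - S.o i' x * S.o i x‖ := norm_sum_le _ _
    _ ≤ ∑ _x : Fin N, 2 * ob ^ 2 := by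
        refine sum_le_sum fun x _ => ?_
        have hob : 0 ≤ ob := (norm_nonneg _).trans (S.norm_o_le i x)
        calc ‖S.o i x * S.o i' x - S.o i' x * S.o i x‖ ≤ 2 * ‖S.o i x‖ * ‖S.o i' x‖ :=
              l2_opNorm_comm_le _ _
          _ ≤ 2 * ob * ob := by
              have h1 := S.norm_o_le i x
              have h2 := S.norm_o_le i' x
              gcongr
          _ = 2 * ob ^ 2 := by ring
    _ = 2 * ob ^ 2 * N := by rw [sum_const, card_univ, Fintype.card_fin, nsmul_eq_mul]; ring

/-- `O^{(i)}_Λ` is Hermitian. [cite: KomaTasaki1993, (2.14)] -/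
theorem isHermitian_orderComp (i : Fin 3) : (∑ x, S.o i x).IsHermitian :=
  (isSelfAdjoint_sum Finset.univ fun x _ => (S.isHermitian_o i x).isSelfAdjoint).isHermitian

/-- `(O_Λ)² = Σ_i (O^{(i)}_Λ)²` is positive semidefinite (each `(O^{(i)})² = (O^{(i)})ᴴ O^{(i)}`).
[cite: KomaTasaki1993, (6.11)] -/
theorem posSemidef_totSq :
    ((∑ x, S.o 0 x) * (∑ x, S.o 0 x) + (∑ x, S.o 1 x) * (∑ x, S.o 1 x)
      + (∑ x, S.o 2 x) * (∑ x, S.o 2 x)).PosSemidef := by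
  have h : ∀ i : Fin 3, ((∑ x, S.o i x) * (∑ x, S.o i x)).PosSemidef := by
    intro i
    have hp := posSemidef_conjTranspose_mul_self (∑ x, S.o i x)
    rwa [(S.isHermitian_orderComp i).eq] at hp
  exact ((h 0).add (h 1)).add (h 2)

/-- **The symmetric Gibbs state is `SU(2)` invariant** (infinitesimal form of KT93 (6.1) for
`⟨·⟩_Λ(0)`): by vi) `[H_Λ, X^{(j)}] = 0` the Gibbs weight `e^{-βH_Λ}` commutes with `X^{(j)}`
(`Commute.exp_right`), so `⟨X^{(j)} A⟩_Λ(0) = ⟨A X^{(j)}⟩_Λ(0)` by cyclicity of the trace.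
[cite: KomaTasaki1993, hypothesis vi) (2.17) and (6.1)] -/
theorem gibbsState_X_mul (β : ℝ) (j : Fin 3) (A : Matrix n n ℂ) :
    gibbsState β (∑ x, S.h x) (S.X j * A) = gibbsState β (∑ x, S.h x) (A * S.X j) := by
  have hc : Commute (S.X j) (gibbsWeight β (∑ x, S.h x)) :=
    ((S.commute_hamiltonian_X j).symm.smul_right (-(β : ℂ))).exp_right
  rw [gibbsState_apply, gibbsState_apply, ← mul_assoc, ← hc.eq, mul_assoc, trace_mul_comm,
    mul_assoc]

/-- `⟨(O^{(2)})²⟩_Λ(0) = ⟨(O^{(1)})²⟩_Λ(0)` and `⟨(O^{(3)})²⟩_Λ(0) = ⟨(O^{(1)})²⟩_Λ(0)` in the symmetric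
Gibbs state (the `k = 1` rotation identity), hence `⟨(O_Λ)²⟩_Λ(0) = 3 ⟨(O^{(1)}_Λ)²⟩_Λ(0)`.
[cite: KomaTasaki1993, Theorem 6.1 (6.13) (`k = 1`), Corollary 2.2] -/
theorem gibbsState_totSq_eq (β : ℝ) :
    gibbsState β (∑ x, S.h x)
        ((∑ x, S.o 0 x) * (∑ x, S.o 0 x) + (∑ x, S.o 1 x) * (∑ x, S.o 1 x)
          + (∑ x, S.o 2 x) * (∑ x, S.o 2 x))
      = 3 * gibbsState β (∑ x, S.h x) ((∑ x, S.o 0 x) * (∑ x, S.o 0 x)) := by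
  have hε₂ : (-Complex.I : ℂ) ≠ 0 := neg_ne_zero.mpr Complex.I_ne_zero
  have hB₂ : S.X 2 * (∑ x, S.o 1 x) - (∑ x, S.o 1 x) * S.X 2 = (-Complex.I) • ∑ x, S.o 0 x := by
    rw [S.X_two_order_one, neg_smul]
  have hA₂ : S.X 2 * (∑ x, S.o 0 x) - (∑ x, S.o 0 x) * S.X 2 = -((-Complex.I) • ∑ x, S.o 1 x) := by
    rw [S.X_two_order_zero, neg_smul, neg_neg]
  have h1 := map_sq_eq_map_sq (gibbsState β (∑ x, S.h x)) (S.X 2) (∑ x, S.o 0 x) (∑ x, S.o 1 x)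
    (S.gibbsState_X_mul β 2) hB₂ hA₂ hε₂
  have h2 := map_sq_eq_map_sq (gibbsState β (∑ x, S.h x)) (S.X 1) (∑ x, S.o 0 x) (∑ x, S.o 2 x)
    (S.gibbsState_X_mul β 1) S.X_one_order_two S.X_one_order_zero Complex.I_ne_zero
  rw [map_add, map_add, h1, h2]
  ring

/-- **KT93 Theorem 6.1 for the symmetric Gibbs states, finite-volume form with explicit constants
(PROVED).**  For the `SU(2)` data i)–vi) of Corollary 2.2 (`SU2System`), every `β`, every `k ≥ 1` and
every volume `N ≥ 1`:
`3^k (N⁻² ⟨(O^{(1)}_Λ)²⟩_Λ(0))^k ≤ (2k+1) N^{-2k} ⟨(O^{(1)}_Λ)^{2k}⟩_Λ(0) + 16 k³ 3^k ō^{2k} / N`,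
i.e. `(N^{-2k}⟨(O^{(1)})^{2k}⟩)^{1/(2k)} ≥ (2k+1)^{-1/(2k)} (3 N⁻²⟨(O^{(1)})²⟩ - O(1/N))^{1/2}` — KT93 (6.14)
with `G_k = 1/(2k+1)`; `N ↑ ∞` then `k ↑ ∞` gives (6.2) with the factor `√3`.  Proof: the rotation
average `re_map_totSq_pow_le` for the Gibbs functional (invariant by `gibbsState_X_mul`, bounded by
`norm_gibbsState_le`, inputs ii), iv), v)), `⟨(O)²⟩ = 3⟨(O^{(1)})²⟩` (`gibbsState_totSq_eq`) and Jensen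
`⟨(O)²⟩^k ≤ ⟨((O)²)^k⟩` (`pow_re_gibbsState_le_re_gibbsState_pow`, KT: Hölder).
[cite: KomaTasaki1993, Theorem 6.1 (6.2), (6.14); Lemma 6.3] -/
theorem kt93_theorem_6_1_fin [Nonempty n] (β : ℝ) {k : ℕ} (hk : 1 ≤ k) (hN : 1 ≤ N) :
    3 ^ k * (S.toZ2System.moment β 1) ^ k
      ≤ (2 * k + 1) * S.toZ2System.moment β k + 16 * (k : ℝ) ^ 3 * 3 ^ k * ob ^ (2 * k) / N := by
  obtain ⟨k, rfl⟩ : ∃ k', k = k' + 1 := ⟨k - 1, by omega⟩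
  have hH : (∑ x, S.h x).IsHermitian := S.toZ2System.isHermitian_hamiltonian
  have hω : ∀ A, ‖gibbsState β (∑ x, S.h x) A‖ ≤ ‖A‖ := fun A => norm_gibbsState_le hH β A
  have hob : 0 ≤ ob := S.ob_nonneg hN
  have hNpos : (0 : ℝ) < N := by exact_mod_cast hN
  have hR : 0 ≤ ob * N := by positivity
  have hc : (0 : ℝ) ≤ 2 * ob := by positivity
  have hc₁ : ‖(∑ x, S.o 1 x) * (∑ x, S.o 0 x) - (∑ x, S.o 0 x) * (∑ x, S.o 1 x)‖
      ≤ 2 * ob * (ob * N) := (S.norm_comm_orderComp_le 1 0).trans_eq (by ring)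
  have hc₂ : ‖(∑ x, S.o 2 x) * (∑ x, S.o 0 x) - (∑ x, S.o 0 x) * (∑ x, S.o 2 x)‖
      ≤ 2 * ob * (ob * N) := (S.norm_comm_orderComp_le 2 0).trans_eq (by ring)
  -- the rotation average (algebraic core of Theorem 6.1)
  have chain := re_map_totSq_pow_le (gibbsState β (∑ x, S.h x)) hω hR hc
    (S.gibbsState_X_mul β 1) (S.gibbsState_X_mul β 2)
    S.X_two_order_zero S.X_two_order_one S.commute_X_two_order_two
    S.X_one_order_zero S.X_one_order_two S.commute_X_one_order_one
    (S.norm_orderComp_le 0) (S.norm_orderComp_le 1) (S.norm_orderComp_le 2) hc₁ hc₂ k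
  -- Jensen in the Gibbs state and `⟨(O)²⟩ = 3⟨(O^{(1)})²⟩`
  have hJ := pow_re_gibbsState_le_re_gibbsState_pow hH S.posSemidef_totSq β (k + 1)
  rw [S.gibbsState_totSq_eq β] at hJ
  have h3re : (3 * gibbsState β (∑ x, S.h x) ((∑ x, S.o 0 x) * (∑ x, S.o 0 x))).re
      = 3 * (gibbsState β (∑ x, S.h x) ((∑ x, S.o 0 x) * (∑ x, S.o 0 x))).re := by
    rw [show (3 : ℂ) = ((3 : ℝ) : ℂ) by norm_num, Complex.re_ofReal_mul]
  rw [h3re] at hJ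
  -- unfold the moments
  set a : ℝ := (gibbsState β (∑ x, S.h x) ((∑ x, S.o 0 x) * (∑ x, S.o 0 x))).re with ha_def
  set b : ℝ := (gibbsState β (∑ x, S.h x) ((∑ x, S.o 0 x) ^ (2 * (k + 1)))).re with hb_def
  have hm1 : S.toZ2System.moment β 1 = ((N : ℝ) ^ 2)⁻¹ * a := by
    rw [Z2System.moment, mul_one, pow_two (S.toZ2System.order)]
    rfl
  have hmk : S.toZ2System.moment β (k + 1) = ((N : ℝ) ^ (2 * (k + 1)))⁻¹ * b := rfl
  have key : (3 * a) ^ (k + 1)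
      ≤ (2 * k + 3) * b + 16 * ((k : ℝ) + 1) ^ 3 * 3 ^ (k + 1) * ob ^ (2 * (k + 1))
          * (N : ℝ) ^ (2 * k + 1) := by
    calc (3 * a) ^ (k + 1)
        ≤ (gibbsState β (∑ x, S.h x) (((∑ x, S.o 0 x) * (∑ x, S.o 0 x)
            + (∑ x, S.o 1 x) * (∑ x, S.o 1 x) + (∑ x, S.o 2 x) * (∑ x, S.o 2 x)) ^ (k + 1))).re := hJ
      _ ≤ (2 * k + 3) * b
          + 2 * (k + 1) * (3 ^ (k + 1) * ((2 * (k : ℝ) + 2) ^ 2 * (2 * ob) * (ob * N) ^ (2 * k + 1))) :=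
          chain
      _ = (2 * k + 3) * b + 16 * ((k : ℝ) + 1) ^ 3 * 3 ^ (k + 1) * ob ^ (2 * (k + 1))
          * (N : ℝ) ^ (2 * k + 1) := by ring
  rw [hm1, hmk]
  have hNpow : (0 : ℝ) < (N : ℝ) ^ (2 * (k + 1)) := pow_pos hNpos _
  have e1 : (3 : ℝ) ^ (k + 1) * (((N : ℝ) ^ 2)⁻¹ * a) ^ (k + 1)
      = ((N : ℝ) ^ (2 * (k + 1)))⁻¹ * (3 * a) ^ (k + 1) := by
    rw [mul_pow, mul_pow, inv_pow, ← pow_mul]; ring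
  rw [e1, inv_mul_le_iff₀ hNpow]
  refine key.trans (le_of_eq ?_)
  have hN0 : (N : ℝ) ≠ 0 := hNpos.ne'
  push_cast
  field_simp
  ring

end SU2System

/-! ### `(2k+1)^{1/(2k)} → 1` and the discharge of Corollary 2.2 -/

/-- `lim_k (2k+1)^{1/(2k)} = 1` in the form used: for every `η > 0` there is `k ≥ 1` with
`(2k+1)^{1/(2k)} ≤ 1 + η` (KT93 (6.5) `lim_k G_k^{1/(2k)} = 1`, `G_k = 1/(2k+1)`; here from Bernoulli's
inequality `(1+η)^{2k} ≥ (1+kη)² ≥ k²η² ≥ 2k+1` once `kη² ≥ 3`). [cite: KomaTasaki1993, Lemma 6.2 (6.5)] -/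
theorem exists_rpow_inv_two_mul_le {η : ℝ} (hη : 0 < η) :
    ∃ k : ℕ, 1 ≤ k ∧ (2 * (k : ℝ) + 1) ^ ((1 : ℝ) / (2 * k)) ≤ 1 + η := by
  obtain ⟨k₀, hk₀⟩ := exists_nat_ge (3 / η ^ 2)
  refine ⟨k₀ + 1, by omega, ?_⟩
  set k : ℕ := k₀ + 1 with hk_def
  have hk1 : (1 : ℝ) ≤ k := by rw [hk_def]; push_cast; linarith [(Nat.cast_nonneg k₀ : (0 : ℝ) ≤ k₀)]
  have hkη : 3 ≤ (k : ℝ) * η ^ 2 := by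
    have hk' : (k₀ : ℝ) ≤ k := by rw [hk_def]; push_cast; linarith
    have h := hk₀.trans hk'
    rwa [div_le_iff₀ (by positivity)] at h
  have hB : 1 + (k : ℝ) * η ≤ (1 + η) ^ k := one_add_mul_le_pow (by linarith) k
  have h2k : (2 * (k : ℝ) + 1) ≤ (1 + η) ^ (2 * k) := by
    have hsq : (1 + η) ^ (2 * k) = ((1 + η) ^ k) ^ 2 := by rw [← pow_mul, mul_comm]
    rw [hsq]
    have h0 : 0 ≤ 1 + (k : ℝ) * η := by positivity
    have hkk : 2 * (k : ℝ) + 1 ≤ (k : ℝ) * ((k : ℝ) * η ^ 2) := by nlinarith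
    calc (2 * (k : ℝ) + 1) ≤ (1 + k * η) ^ 2 := by nlinarith
      _ ≤ ((1 + η) ^ k) ^ 2 := pow_le_pow_left₀ h0 hB 2
  have hk0 : 2 * k ≠ 0 := by omega
  have hpow : (1 : ℝ) / (2 * k) = (((2 * k : ℕ) : ℝ))⁻¹ := by push_cast; rw [one_div]
  have h := Real.rpow_le_rpow (by positivity) h2k (by positivity : (0 : ℝ) ≤ 1 / (2 * k))
  rw [hpow] at h ⊢
  rwa [Real.pow_rpow_inv_natCast (by linarith) hk0] at h

/-- **Koma–Tasaki 1993, Corollary 2.2 — PROVED** (discharge of the named fact `kt93_corollary_2_2`;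
"follows from Theorem 2.1 and Theorem 6.1").  *For an arbitrary sequence of models satisfying the
assumptions i)–vi), `m_s ≥ √3 σ` (2.18) for any inverse temperature `β`*, in the form (2.13′)
established by the printed proof: for every `B > 0` and `ε > 0`, eventually in `j, j'`,
`√3 (N_{j'}⁻²⟨(O^{(1)})²⟩_{Λ_{j'}}(0))^{1/2} ≤ N_j⁻¹⟨O^{(1)}⟩_{Λ_j}(B) + ε`.  Proof = KT93's: Theorem 2.1
(`kt93_theorem_2_1_holds`) for the first component at a fixed large `k` (chosen with
`(2k+1)^{1/(2k)} ≤ 1 + η`, `η(ō + ε) = ε/2`, `exists_rpow_inv_two_mul_le`) bounds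
`(N^{-2k}⟨(O^{(1)})^{2k}⟩)^{1/(2k)}` by the magnetisation, and Theorem 6.1 in finite volume
(`SU2System.kt93_theorem_6_1_fin`) bounds `√3 (N⁻²⟨(O^{(1)})²⟩)^{1/2}` by
`(2k+1)^{1/(2k)} ((N^{-2k}⟨(O^{(1)})^{2k}⟩)^{1/(2k)} + O(N^{-1/(2k)}))`; `N_j → ∞`.
[cite: KomaTasaki1993, Corollary 2.2 (2.18); Theorem 6.1 (6.2), (6.14); Theorem 2.1 (2.13)] -/
theorem kt93_corollary_2_2_holds : kt93_corollary_2_2.{v} := by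
  intro hb ob r N n _ _ _ sys β hβ hN hlim B hB ε hε
  -- Theorem 2.1 for the first components
  have h21 := kt93_theorem_2_1_holds hb ob r N n (fun j => (sys j).toZ2System) β hβ hN hlim
  -- `ō ≥ 0` (there is a volume with a site)
  obtain ⟨j₁, hj₁⟩ := Filter.eventually_atTop.mp (hN.eventually_ge_atTop 1)
  have hob : 0 ≤ ob := (sys j₁).ob_nonneg (hj₁ j₁ le_rfl)
  -- the slack `η` with `η (ō + ε) = ε/2`
  have hobε : 0 < ob + ε := by linarith
  set η : ℝ := ε / (2 * (ob + ε)) with hη_def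
  have hη : 0 < η := by positivity
  have hηε : η * (ob + ε) = ε / 2 := by
    rw [hη_def]; field_simp
  -- choice of `k`, then Theorem 2.1 at `(k, ε/4)`
  obtain ⟨k, hk, hθ⟩ := exists_rpow_inv_two_mul_le hη
  have hk0 : 2 * k ≠ 0 := by omega
  obtain ⟨j₂, hj₂⟩ := h21 k hk B hB (ε / 4) (by positivity)
  -- the finite-volume error of Theorem 6.1 is eventually `≤ (2k+1)(ε/4)^{2k}`
  set cst : ℝ := 16 * (k : ℝ) ^ 3 * 3 ^ k * ob ^ (2 * k) with hcst_def
  have htarget : 0 < (2 * (k : ℝ) + 1) * (ε / 4) ^ (2 * k) := by positivity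
  have hE : ∀ᶠ j in atTop, cst / (N j : ℝ) ≤ (2 * (k : ℝ) + 1) * (ε / 4) ^ (2 * k) := by
    have hT : Tendsto (fun j => cst / (N j : ℝ)) atTop (𝓝 0) :=
      tendsto_const_nhds.div_atTop (tendsto_natCast_atTop_atTop.comp hN)
    exact hT.eventually (eventually_le_nhds htarget)
  obtain ⟨j₃, hj₃⟩ := Filter.eventually_atTop.mp ((hN.eventually_ge_atTop 1).and hE)
  refine ⟨max j₂ j₃, fun j j' hj hj' => ?_⟩
  obtain ⟨hN1, hErr⟩ := hj₃ j' ((le_max_right _ _).trans hj')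
  have hmag := hj₂ j j' ((le_max_left _ _).trans hj) ((le_max_left _ _).trans hj')
  have hmag_le : (sys j).toZ2System.magnetisation β B ≤ ob :=
    (abs_le.mp ((sys j).toZ2System.abs_magnetisation_le hob β B)).2
  have hm1 : 0 ≤ (sys j').toZ2System.moment β 1 := (sys j').toZ2System.moment_nonneg β 1
  have hmk : 0 ≤ (sys j').toZ2System.moment β k := (sys j').toZ2System.moment_nonneg β k
  -- Theorem 6.1 in finite volume
  have hfin := (sys j').kt93_theorem_6_1_fin β hk hN1
  have hfin' : (3 * (sys j').toZ2System.moment β 1) ^ k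
      ≤ (2 * (k : ℝ) + 1) * ((sys j').toZ2System.moment β k + (ε / 4) ^ (2 * k)) := by
    rw [mul_pow, mul_add]
    have : 16 * (k : ℝ) ^ 3 * 3 ^ k * ob ^ (2 * k) / (N j' : ℝ) ≤
        (2 * (k : ℝ) + 1) * (ε / 4) ^ (2 * k) := hErr
    linarith
  -- `2k`-th roots
  set p : ℝ := (1 : ℝ) / (2 * k) with hp_def
  have hp0 : 0 ≤ p := by positivity
  have hk1 : (1 : ℝ) ≤ k := by exact_mod_cast hk
  have hp1 : p ≤ 1 := by
    rw [hp_def, div_le_one (by positivity)]; linarith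
  have hpinv : p = (((2 * k : ℕ) : ℝ))⁻¹ := by rw [hp_def]; push_cast; rw [one_div]
  have hL : Real.sqrt 3 * Real.sqrt ((sys j').toZ2System.moment β 1)
      = ((3 * (sys j').toZ2System.moment β 1) ^ k) ^ p := by
    rw [← Real.sqrt_mul (by norm_num : (0 : ℝ) ≤ 3), Real.sqrt_eq_rpow, ← Real.rpow_natCast,
      ← Real.rpow_mul (by positivity : (0 : ℝ) ≤ 3 * (sys j').toZ2System.moment β 1)]
    congr 1
    rw [hp_def]; field_simp
  have hR1 : ((3 * (sys j').toZ2System.moment β 1) ^ k) ^ p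
      ≤ ((2 * (k : ℝ) + 1) * ((sys j').toZ2System.moment β k + (ε / 4) ^ (2 * k))) ^ p :=
    Real.rpow_le_rpow (by positivity) hfin' hp0
  have hR2 : ((2 * (k : ℝ) + 1) * ((sys j').toZ2System.moment β k + (ε / 4) ^ (2 * k))) ^ p
      = (2 * (k : ℝ) + 1) ^ p * ((sys j').toZ2System.moment β k + (ε / 4) ^ (2 * k)) ^ p :=
    Real.mul_rpow (by positivity) (by positivity)
  have hR4 : ((ε / 4) ^ (2 * k)) ^ p = ε / 4 := by
    rw [hpinv, Real.pow_rpow_inv_natCast (by positivity) hk0]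
  have hR3 : ((sys j').toZ2System.moment β k + (ε / 4) ^ (2 * k)) ^ p
      ≤ ((sys j').toZ2System.moment β k) ^ p + ε / 4 := by
    have h := Real.rpow_add_le_add_rpow hmk (by positivity : (0 : ℝ) ≤ (ε / 4) ^ (2 * k)) hp0 hp1
    rwa [hR4] at h
  have hx0 : 0 ≤ ((sys j').toZ2System.moment β k) ^ p := by positivity
  have hθ0 : 0 ≤ (2 * (k : ℝ) + 1) ^ p := by positivity
  calc Real.sqrt 3 * Real.sqrt ((sys j').toZ2System.moment β 1)
      = ((3 * (sys j').toZ2System.moment β 1) ^ k) ^ p := hL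
    _ ≤ (2 * (k : ℝ) + 1) ^ p * ((sys j').toZ2System.moment β k + (ε / 4) ^ (2 * k)) ^ p := by
        rw [← hR2]; exact hR1
    _ ≤ (1 + η) * (((sys j').toZ2System.moment β k) ^ p + ε / 4) :=
        mul_le_mul hθ hR3 (by positivity) (by linarith)
    _ ≤ (1 + η) * ((sys j).toZ2System.magnetisation β B + ε / 4 + ε / 4) :=
        mul_le_mul_of_nonneg_left (by linarith [hmag]) (by linarith)
    _ = ((sys j).toZ2System.magnetisation β B + ε / 2)
        + η * ((sys j).toZ2System.magnetisation β B + ε / 2) := by ring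
    _ ≤ ((sys j).toZ2System.magnetisation β B + ε / 2) + η * (ob + ε) := by
        have h1 : (sys j).toZ2System.magnetisation β B + ε / 2 ≤ ob + ε := by linarith
        have h2 := mul_le_mul_of_nonneg_left h1 hη.le
        linarith
    _ = (sys j).toZ2System.magnetisation β B + ε := by rw [hηε]; ring

/-! ### The `SO(2) = U(1)` case (KT93 Remark after Theorem 6.1): factor `√2` -/

/-- **KT93 Theorem 6.1 for an `SO(2) = U(1)` symmetry, algebraic core in state form** (KT93 Remark
after Theorem 6.1: "When a system has an `SO(n)` invariance, one gets a bound similar to (6.2) with the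
factor `√3` replaced with `√n` … The most important of these extensions are the models with an
`SO(2) = U(1)` invariance, where we get a factor `√2` … the electron pair condensation problems in
lattice electron systems").  One generator `G` rotating the pair `(O₀, O₁)`, `[G, O₁] = ε O₀`,
`[G, O₀] = -ε O₁` (`ε ≠ 0`), a linear functional `ω` with `‖ω A‖ ≤ ‖A‖` and `ω(G A) = ω(A G)`,
`‖O₀‖, ‖O₁‖ ≤ R`, `‖[O₁, O₀]‖ ≤ c R`, and `Re ω(O₀^{2(k+1)}) ≥ 0`: then with `Q = O₀² + O₁²`,
`Re ω(Q^{k+1}) ≤ (2k+3) Re ω(O₀^{2(k+1)}) + (k+1) · 2^{k+1} (2k+2)² c R^{2k+1}`.  The peeling factor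
is `Π_{K≤k} (2K+2)/(2K+1) = 1/G_k^{U(1)}` with `G_k^{U(1)} = (2π)⁻¹∫cos^{2k} = (2k)!/(4^k (k!)²)` the
circle average (bounded here by `2k+3`, which is all that `G_k^{1/(2k)} → 1` needs); this is the
state-form twin of the tree's vector-state `U1System.stepQ` (KT93 Lemma 7.5).
[cite: KomaTasaki1993, Theorem 6.1 and Remark after Theorem 6.1 (SO(2): factor √2), Lemma 6.3, Lemma 7.5 (7.18)–(7.19)] -/
theorem re_map_sqSum_pow_le (ω : Matrix n n ℂ →ₗ[ℂ] ℂ) (hω : ∀ A, ‖ω A‖ ≤ ‖A‖)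
    {O₀ O₁ G : Matrix n n ℂ} {ε : ℂ} {R c : ℝ} (hR : 0 ≤ R) (hc : 0 ≤ c)
    (hG : ∀ A, ω (G * A) = ω (A * G))
    (hB : G * O₁ - O₁ * G = ε • O₀) (hA : G * O₀ - O₀ * G = -(ε • O₁)) (hε : ε ≠ 0)
    (hO₀ : ‖O₀‖ ≤ R) (hO₁ : ‖O₁‖ ≤ R) (hc₁ : ‖O₁ * O₀ - O₀ * O₁‖ ≤ c * R) (k : ℕ)
    (hpos : 0 ≤ (ω (O₀ ^ (2 * (k + 1)))).re) :
    (ω ((O₀ * O₀ + O₁ * O₁) ^ (k + 1))).re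
      ≤ (2 * k + 3) * (ω (O₀ ^ (2 * (k + 1)))).re
        + (k + 1) * (2 ^ (k + 1) * ((2 * (k : ℝ) + 2) ^ 2 * c * R ^ (2 * k + 1))) := by
  set Q : Matrix n n ℂ := O₀ * O₀ + O₁ * O₁ with hQ_def
  -- `Q` commutes with the generator
  have hQG : Commute G Q := by
    have hA' : G * O₀ = O₀ * G + (-ε) • O₁ := by
      rw [neg_smul]; exact sub_eq_iff_eq_add'.mp hA
    have hB' : G * O₁ = O₁ * G - (-ε) • O₀ := by
      rw [neg_smul, sub_neg_eq_add]; exact sub_eq_iff_eq_add'.mp hB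
    exact commute_sq_add_sq_of G O₀ O₁ (-ε) hA' hB'
  -- norm of `Q`
  have hQn : ‖Q‖ ≤ 2 * R ^ 2 := by
    calc ‖Q‖ ≤ ‖O₀ * O₀‖ + ‖O₁ * O₁‖ := norm_add_le _ _
      _ ≤ ‖O₀‖ * ‖O₀‖ + ‖O₁‖ * ‖O₁‖ := add_le_add (l2_opNorm_mul _ _) (l2_opNorm_mul _ _)
      _ ≤ R * R + R * R := by gcongr
      _ = 2 * R ^ 2 := by ring
  -- one peeling step: `(2K+1) Re ω(Q^{j+1} O₀^{2K}) ≤ (2K+2) Re ω(Q^j O₀^{2K+2}) + (2R²)^j (2K+1)² c R^{2K+1}`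
  have stepQ : ∀ j K : ℕ,
      (2 * K + 1) * (ω (Q ^ (j + 1) * O₀ ^ (2 * K))).re
        ≤ (2 * K + 2) * (ω (Q ^ j * O₀ ^ (2 * K + 2))).re
          + (2 * R ^ 2) ^ j * ((2 * (K : ℝ) + 1) ^ 2 * c * R ^ (2 * K + 1)) := by
    intro j K
    have hsplit : Q ^ (j + 1) * O₀ ^ (2 * K) =
        Q ^ j * O₀ ^ (2 * K + 2) + Q ^ j * (O₁ * O₁ * O₀ ^ (2 * K)) := by
      have hsq : O₀ * O₀ * O₀ ^ (2 * K) = O₀ ^ (2 * K + 2) := by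
        rw [pow_succ', pow_succ', mul_assoc]
      rw [pow_succ, mul_assoc, hQ_def, add_mul, hsq, mul_add]
    have hW : Commute G (Q ^ j) := hQG.pow_right j
    have hWn : ‖Q ^ j‖ ≤ (2 * R ^ 2) ^ j := l2_opNorm_pow_le hQn j
    have h2 := rot_estimate_map ω hω G (Q ^ j) O₀ O₁ hG hW hB hA hε hR hc hO₀ hO₁ hc₁ hWn
      (2 * K + 1)
    rw [show 2 * K + 1 - 1 = 2 * K by omega, show 2 * K + 1 + 1 = 2 * K + 2 by omega] at h2
    rw [hsplit, map_add, Complex.add_re]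
    push_cast at h2 ⊢
    obtain ⟨h2a, h2b⟩ := abs_le.mp h2
    nlinarith [h2a, h2b]
  -- uniform bound for the peeling errors
  set e : ℝ := 2 ^ (k + 1) * ((2 * (k : ℝ) + 2) ^ 2 * c * R ^ (2 * k + 1)) with he_def
  have peel : ∀ K : ℕ, K ≤ k →
      (2 * R ^ 2) ^ (k - K) * ((2 * (K : ℝ) + 1) ^ 2 * c * R ^ (2 * K + 1)) ≤ e := by
    intro K hK
    have e1 : (2 * R ^ 2) ^ (k - K) * ((2 * (K : ℝ) + 1) ^ 2 * c * R ^ (2 * K + 1))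
        = 2 ^ (k - K) * ((2 * (K : ℝ) + 1) ^ 2 * c * R ^ (2 * k + 1)) := by
      rw [mul_pow, ← pow_mul, show R ^ (2 * k + 1) = R ^ (2 * (k - K)) * R ^ (2 * K + 1) by
        rw [← pow_add]; congr 1; omega]
      ring
    rw [e1, he_def]
    have h1 : (2 : ℝ) ^ (k - K) ≤ 2 ^ (k + 1) := pow_le_pow_right₀ (by norm_num) (by omega)
    have h2 : (2 * (K : ℝ) + 1) ^ 2 ≤ (2 * (k : ℝ) + 2) ^ 2 := by
      have : (K : ℝ) ≤ k := by exact_mod_cast hK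
      nlinarith
    have h0 : 0 ≤ (2 : ℝ) ^ (k - K) := pow_nonneg (by norm_num) _
    gcongr
  have he0 : 0 ≤ e := by positivity
  -- the circle-average factor `b K = Π_{i<K} (2i+2)/(2i+1)`, `1 ≤ b K ≤ 2K+1`
  set b : ℕ → ℝ := fun K => ∏ i ∈ range K, ((2 * (i : ℝ) + 2) / (2 * i + 1)) with hb_def
  have hb0 : b 0 = 1 := by simp [hb_def]
  have hb_succ : ∀ K, b (K + 1) = b K * ((2 * (K : ℝ) + 2) / (2 * K + 1)) := fun K => by
    simp only [hb_def]
    rw [prod_range_succ]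
  have hb1 : ∀ K, 1 ≤ b K := by
    intro K
    induction K with
    | zero => rw [hb0]
    | succ K ih =>
      have hf1 : (1 : ℝ) ≤ (2 * (K : ℝ) + 2) / (2 * K + 1) := by
        rw [le_div_iff₀ (by positivity)]; linarith
      rw [hb_succ]; nlinarith
  have hble : ∀ K, b K ≤ 2 * K + 1 := by
    intro K
    induction K with
    | zero => rw [hb0]; norm_num
    | succ K ih =>
      rw [hb_succ]
      have hpos : (0 : ℝ) < 2 * K + 1 := by positivity
      have h1 : b K * ((2 * (K : ℝ) + 2) / (2 * K + 1)) ≤ (2 * K + 1) * ((2 * (K : ℝ) + 2) / (2 * K + 1)) :=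
        mul_le_mul_of_nonneg_right ih (by positivity)
      have h2 : (2 * (K : ℝ) + 1) * ((2 * (K : ℝ) + 2) / (2 * K + 1)) = 2 * K + 2 := by
        field_simp
      push_cast
      linarith
  -- the chain `Re ω(Q^{k+1}) ≤ b K · Re ω(Q^{k+1-K} O₀^{2K}) + K e`
  have keyQ : ∀ K, K ≤ k + 1 →
      (ω (Q ^ (k + 1) * O₀ ^ (2 * 0))).re
        ≤ b K * (ω (Q ^ (k + 1 - K) * O₀ ^ (2 * K))).re + K * e := by
    intro K
    induction K with
    | zero => intro _; simp [hb0]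
    | succ K ih =>
      intro hK
      have ih' := ih (by omega)
      have hs := stepQ (k - K) K
      have hp := peel K (by omega)
      rw [show k - K + 1 = k + 1 - K by omega] at hs
      rw [show k + 1 - (K + 1) = k - K by omega, show 2 * (K + 1) = 2 * K + 2 by ring, hb_succ]
      set X0 := (ω (Q ^ (k + 1 - K) * O₀ ^ (2 * K))).re with hX0
      set X1 := (ω (Q ^ (k - K) * O₀ ^ (2 * K + 2))).re with hX1
      set E : ℝ := (2 * R ^ 2) ^ (k - K) * ((2 * (K : ℝ) + 1) ^ 2 * c * R ^ (2 * K + 1)) with hE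
      have hKpos : (0 : ℝ) < 2 * K + 1 := by positivity
      have hbK : 1 ≤ b K := hb1 K
      have hbK' : b K ≤ 2 * K + 1 := hble K
      have hE0 : 0 ≤ E := by positivity
      push_cast at hs ih' ⊢
      -- `X0 ≤ f X1 + E/(2K+1)`
      have key : X0 ≤ ((2 * (K : ℝ) + 2) / (2 * K + 1)) * X1 + E / (2 * K + 1) := by
        rw [div_mul_eq_mul_div, ← add_div, le_div_iff₀ hKpos]; linarith
      have s1 : b K * X0 ≤ b K * (((2 * (K : ℝ) + 2) / (2 * K + 1)) * X1 + E / (2 * K + 1)) :=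
        mul_le_mul_of_nonneg_left key (by linarith)
      have s2 : b K * (E / (2 * K + 1)) ≤ E := by
        calc b K * (E / (2 * K + 1)) ≤ (2 * K + 1) * (E / (2 * K + 1)) :=
              mul_le_mul_of_nonneg_right hbK' (by positivity)
          _ = E := by field_simp
      have e1 : b K * (((2 * (K : ℝ) + 2) / (2 * K + 1)) * X1 + E / (2 * K + 1))
          = b K * ((2 * (K : ℝ) + 2) / (2 * K + 1)) * X1 + b K * (E / (2 * K + 1)) := by ring
      linarith [s1, s2, e1, ih', hp]
  have hQ := keyQ (k + 1) le_rfl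
  rw [Nat.sub_self, Nat.mul_zero, pow_zero, pow_zero, mul_one, one_mul] at hQ
  push_cast at hQ
  have hbk : b (k + 1) ≤ 2 * (k + 1 : ℕ) + 1 := hble (k + 1)
  push_cast at hbk
  have hlast : b (k + 1) * (ω (O₀ ^ (2 * (k + 1)))).re ≤ (2 * k + 3) * (ω (O₀ ^ (2 * (k + 1)))).re := by
    have := mul_le_mul_of_nonneg_right hbk hpos
    linarith
  linarith

/-- **Symmetric Gibbs states are invariant under a conserved generator**: if `[H, C] = 0` then
`⟨C A⟩_β = ⟨A C⟩_β` (the Gibbs weight commutes with `C`, `Commute.exp_right`, and cyclicity of the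
trace) — the infinitesimal form of KT93 (6.1) for `⟨·⟩_Λ(0)`. [cite: KomaTasaki1993, (6.1) with vi) (2.17)] -/
theorem gibbsState_mul_comm_of_commute {H C : Matrix n n ℂ} (hHC : Commute H C) (β : ℝ)
    (A : Matrix n n ℂ) : gibbsState β H (C * A) = gibbsState β H (A * C) := by
  have hc : Commute C (gibbsWeight β H) := (hHC.symm.smul_right (-(β : ℂ))).exp_right
  rw [gibbsState_apply, gibbsState_apply, ← mul_assoc, ← hc.eq, mul_assoc, trace_mul_comm,
    mul_assoc]

namespace Z2System

variable (sys : Z2System N hb ob r n)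

/-- **KT93 Theorem 6.1 with an `SO(2) = U(1)` symmetry for the symmetric Gibbs states, finite-volume
form with explicit constants (PROVED)** (KT93 Remark after Theorem 6.1, factor `√2`: "quantum
antiferromagnets with an XY-like anisotropy, or the electron pair condensation problems in lattice
electron systems").  Data: a `Z2System` (`O_Λ = O^{(1)}`), a second Hermitian component `O^{(2)}` with
`‖O^{(2)}‖ ≤ ōN`, and a generator `C` with vi) `[H_Λ, C] = 0` and v) `[C, O^{(2)}] = ε O^{(1)}`,
`[C, O^{(1)}] = -ε O^{(2)}` for some `ε ≠ 0` (e.g. `C = N̂`, `O^{(1)} = Σ(Δ_x + Δ_x†)`,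
`O^{(2)} = Σ i(Δ_x - Δ_x†)`, `ε = -2i`), and a commutator bound `‖[O^{(2)}, O^{(1)}]‖ ≤ κ ō² N` (KT's iv)
`[o^{(i)}_x, o^{(j)}_y] = 0` for `x ≠ y` gives `κ = 2` by Lemma 6.3; densities on overlapping bonds — the
d-wave pair field — give `κ = 2 × (maximal number of densities not commuting with a given one)`; only the
bound enters).  Then for every `β`, `k ≥ 1`, `N ≥ 1`:
`2^k (N⁻²⟨(O^{(1)})²⟩_Λ(0))^k ≤ (2k+1) N^{-2k}⟨(O^{(1)})^{2k}⟩_Λ(0) + 4κ k³ 2^k ō^{2k} / N`.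
[cite: KomaTasaki1993, Theorem 6.1 (6.14) and Remark after Theorem 6.1 (SO(2) = U(1), factor √2); Lemma 6.3] -/
theorem kt93_theorem_6_1_u1_fin [Nonempty n] {O₂ C : Matrix n n ℂ} {ε : ℂ} {κ : ℝ}
    (hO₂h : O₂.IsHermitian) (hC : Commute sys.hamiltonian C)
    (hrot₁ : C * O₂ - O₂ * C = ε • sys.order) (hrot₂ : C * sys.order - sys.order * C = -(ε • O₂))
    (hε : ε ≠ 0) (hO₂ : ‖O₂‖ ≤ ob * N)
    (hκ : ‖O₂ * sys.order - sys.order * O₂‖ ≤ κ * ob ^ 2 * N) (hκ0 : 0 ≤ κ)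
    (β : ℝ) {k : ℕ} (hk : 1 ≤ k) (hN : 1 ≤ N) :
    2 ^ k * (sys.moment β 1) ^ k
      ≤ (2 * k + 1) * sys.moment β k + 4 * κ * (k : ℝ) ^ 3 * 2 ^ k * ob ^ (2 * k) / N := by
  obtain ⟨k, rfl⟩ : ∃ k', k = k' + 1 := ⟨k - 1, by omega⟩
  have hH : sys.hamiltonian.IsHermitian := sys.isHermitian_hamiltonian
  have hω : ∀ A, ‖gibbsState β sys.hamiltonian A‖ ≤ ‖A‖ := fun A => norm_gibbsState_le hH β A
  have hob : 0 ≤ ob := (norm_nonneg _).trans (sys.norm_o_le ⟨0, hN⟩)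
  have hNpos : (0 : ℝ) < N := by exact_mod_cast hN
  have hR : 0 ≤ ob * N := by positivity
  have hc : (0 : ℝ) ≤ κ * ob := by positivity
  have hO₀ : ‖sys.order‖ ≤ ob * N := sys.norm_order_le.trans_eq (by ring)
  have hc₁ : ‖O₂ * sys.order - sys.order * O₂‖ ≤ κ * ob * (ob * N) := hκ.trans_eq (by ring)
  have hpos : 0 ≤ (gibbsState β sys.hamiltonian (sys.order ^ (2 * (k + 1)))).re :=
    (Complex.nonneg_iff.mp
      (gibbsState_nonneg_of_posSemidef β hH (sys.posSemidef_order_pow (k + 1)))).1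
  -- the rotation average (algebraic core, `U(1)` case)
  have chain := re_map_sqSum_pow_le (gibbsState β sys.hamiltonian) hω hR hc
    (gibbsState_mul_comm_of_commute hC β) hrot₁ hrot₂ hε hO₀ hO₂ hc₁ k hpos
  -- Jensen in the Gibbs state and `⟨(O^{(1)})² + (O^{(2)})²⟩ = 2⟨(O^{(1)})²⟩`
  have hQpsd : (sys.order * sys.order + O₂ * O₂).PosSemidef := by
    have h0 := posSemidef_conjTranspose_mul_self sys.order
    rw [sys.isHermitian_order.eq] at h0
    have h2 := posSemidef_conjTranspose_mul_self O₂
    rw [hO₂h.eq] at h2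
    exact h0.add h2
  have hJ := pow_re_gibbsState_le_re_gibbsState_pow hH hQpsd β (k + 1)
  have hsq : gibbsState β sys.hamiltonian (O₂ * O₂)
      = gibbsState β sys.hamiltonian (sys.order * sys.order) :=
    map_sq_eq_map_sq (gibbsState β sys.hamiltonian) C sys.order O₂
      (gibbsState_mul_comm_of_commute hC β) hrot₁ hrot₂ hε
  have h2re : (gibbsState β sys.hamiltonian (sys.order * sys.order + O₂ * O₂)).re
      = 2 * (gibbsState β sys.hamiltonian (sys.order * sys.order)).re := by
    rw [map_add, hsq, Complex.add_re]; ring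
  rw [h2re] at hJ
  -- unfold the moments
  set a : ℝ := (gibbsState β sys.hamiltonian (sys.order * sys.order)).re with ha_def
  set bb : ℝ := (gibbsState β sys.hamiltonian (sys.order ^ (2 * (k + 1)))).re with hb_def
  have hm1 : sys.moment β 1 = ((N : ℝ) ^ 2)⁻¹ * a := by
    rw [Z2System.moment, mul_one, pow_two sys.order]
  have hmk : sys.moment β (k + 1) = ((N : ℝ) ^ (2 * (k + 1)))⁻¹ * bb := rfl
  have key : (2 * a) ^ (k + 1)
      ≤ (2 * k + 3) * bb + 4 * κ * ((k : ℝ) + 1) ^ 3 * 2 ^ (k + 1) * ob ^ (2 * (k + 1))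
          * (N : ℝ) ^ (2 * k + 1) := by
    calc (2 * a) ^ (k + 1)
        ≤ (gibbsState β sys.hamiltonian ((sys.order * sys.order + O₂ * O₂) ^ (k + 1))).re := hJ
      _ ≤ (2 * k + 3) * bb
          + (k + 1) * (2 ^ (k + 1) * ((2 * (k : ℝ) + 2) ^ 2 * (κ * ob) * (ob * N) ^ (2 * k + 1))) :=
          chain
      _ = (2 * k + 3) * bb + 4 * κ * ((k : ℝ) + 1) ^ 3 * 2 ^ (k + 1) * ob ^ (2 * (k + 1))
          * (N : ℝ) ^ (2 * k + 1) := by ring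
  rw [hm1, hmk]
  have hNpow : (0 : ℝ) < (N : ℝ) ^ (2 * (k + 1)) := pow_pos hNpos _
  have e1 : (2 : ℝ) ^ (k + 1) * (((N : ℝ) ^ 2)⁻¹ * a) ^ (k + 1)
      = ((N : ℝ) ^ (2 * (k + 1)))⁻¹ * (2 * a) ^ (k + 1) := by
    rw [mul_pow, mul_pow, inv_pow, ← pow_mul]; ring
  rw [e1, inv_mul_le_iff₀ hNpow]
  refine key.trans (le_of_eq ?_)
  have hN0 : (N : ℝ) ≠ 0 := hNpos.ne'
  push_cast
  field_simp
  ring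

/-- **From a finite-volume moment chain to the `√a` bound (the limit step shared by the `SU(2)` and
`U(1)` cases).**  If along a sequence of `Z2System`s with hypothesis i) one has, at every volume
`N_j ≥ 1` and every `k ≥ 1`, `a^k (N⁻²⟨O²⟩)^k ≤ (2k+1) N^{-2k}⟨O^{2k}⟩ + c_k/N_j` (`a ≥ 0`),
then for every `B > 0`, `ε > 0`, eventually in `j, j'`:
`√a · (N_{j'}⁻²⟨O²⟩_{Λ_{j'}}(0))^{1/2} ≤ N_j⁻¹⟨O⟩_{Λ_j}(B) + ε` — Theorem 2.1 (`kt93_theorem_2_1_holds`) at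
a fixed large `k` with `(2k+1)^{1/(2k)} ≤ 1 + η` and `N_j → ∞` (KT93 proof of Theorem 6.1, last
paragraph: "by letting `N ↑ ∞` and then `k ↑ ∞`").
[cite: KomaTasaki1993, Theorem 6.1 (6.14)–(6.15) and Corollary 2.2; Theorem 2.1 (2.13)] -/
theorem sqrt_mul_sqrt_moment_le_of_chain
    {hb ob : ℝ} {r : ℕ} {N : ℕ → ℕ} {n : ℕ → Type v} [∀ j, Fintype (n j)]
    [∀ j, DecidableEq (n j)] [∀ j, Nonempty (n j)] (sys : (j : ℕ) → Z2System (N j) hb ob r (n j))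
    {β : ℝ} (hβ : 0 < β) (hN : Tendsto N atTop atTop)
    (hlim : ∀ B : ℝ, ∃ f : ℝ, Tendsto (fun j => (sys j).freeEnergy β B) atTop (𝓝 f))
    {a : ℝ} (ha : 0 ≤ a) (cst : ℕ → ℝ)
    (hchain : ∀ k : ℕ, 1 ≤ k → ∀ j : ℕ, 1 ≤ N j →
      a ^ k * ((sys j).moment β 1) ^ k ≤ (2 * k + 1) * (sys j).moment β k + cst k / N j) :
    ∀ B : ℝ, 0 < B → ∀ ε : ℝ, 0 < ε → ∃ j₀ : ℕ, ∀ j j' : ℕ, j₀ ≤ j → j₀ ≤ j' →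
      Real.sqrt a * Real.sqrt ((sys j').moment β 1) ≤ (sys j).magnetisation β B + ε := by
  intro B hB ε hε
  have h21 := kt93_theorem_2_1_holds hb ob r N n sys β hβ hN hlim
  -- `ō ≥ 0` (there is a volume with a site)
  obtain ⟨j₁, hj₁⟩ := Filter.eventually_atTop.mp (hN.eventually_ge_atTop 1)
  have hob : 0 ≤ ob := (norm_nonneg _).trans ((sys j₁).norm_o_le ⟨0, hj₁ j₁ le_rfl⟩)
  -- the slack `η` with `η (ō + ε) = ε/2`
  have hobε : 0 < ob + ε := by linarith
  set η : ℝ := ε / (2 * (ob + ε)) with hη_def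
  have hη : 0 < η := by positivity
  have hηε : η * (ob + ε) = ε / 2 := by
    rw [hη_def]; field_simp
  -- choice of `k`, then Theorem 2.1 at `(k, ε/4)`
  obtain ⟨k, hk, hθ⟩ := exists_rpow_inv_two_mul_le hη
  have hk0 : 2 * k ≠ 0 := by omega
  obtain ⟨j₂, hj₂⟩ := h21 k hk B hB (ε / 4) (by positivity)
  -- the finite-volume error is eventually `≤ (2k+1)(ε/4)^{2k}`
  have htarget : 0 < (2 * (k : ℝ) + 1) * (ε / 4) ^ (2 * k) := by positivity
  have hE : ∀ᶠ j in atTop, cst k / (N j : ℝ) ≤ (2 * (k : ℝ) + 1) * (ε / 4) ^ (2 * k) := by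
    have hT : Tendsto (fun j => cst k / (N j : ℝ)) atTop (𝓝 0) :=
      tendsto_const_nhds.div_atTop (tendsto_natCast_atTop_atTop.comp hN)
    exact hT.eventually (eventually_le_nhds htarget)
  obtain ⟨j₃, hj₃⟩ := Filter.eventually_atTop.mp ((hN.eventually_ge_atTop 1).and hE)
  refine ⟨max j₂ j₃, fun j j' hj hj' => ?_⟩
  obtain ⟨hN1, hErr⟩ := hj₃ j' ((le_max_right _ _).trans hj')
  have hmag := hj₂ j j' ((le_max_left _ _).trans hj) ((le_max_left _ _).trans hj')
  have hmag_le : (sys j).magnetisation β B ≤ ob :=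
    (abs_le.mp ((sys j).abs_magnetisation_le hob β B)).2
  have hm1 : 0 ≤ (sys j').moment β 1 := (sys j').moment_nonneg β 1
  have hmk : 0 ≤ (sys j').moment β k := (sys j').moment_nonneg β k
  -- the chain in finite volume
  have hfin := hchain k hk j' hN1
  have hfin' : (a * (sys j').moment β 1) ^ k
      ≤ (2 * (k : ℝ) + 1) * ((sys j').moment β k + (ε / 4) ^ (2 * k)) := by
    rw [mul_pow, mul_add]
    linarith
  -- `2k`-th roots
  set p : ℝ := (1 : ℝ) / (2 * k) with hp_def
  have hp0 : 0 ≤ p := by positivity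
  have hk1 : (1 : ℝ) ≤ k := by exact_mod_cast hk
  have hp1 : p ≤ 1 := by
    rw [hp_def, div_le_one (by positivity)]; linarith
  have hpinv : p = (((2 * k : ℕ) : ℝ))⁻¹ := by rw [hp_def]; push_cast; rw [one_div]
  have hL : Real.sqrt a * Real.sqrt ((sys j').moment β 1)
      = ((a * (sys j').moment β 1) ^ k) ^ p := by
    rw [← Real.sqrt_mul ha, Real.sqrt_eq_rpow, ← Real.rpow_natCast,
      ← Real.rpow_mul (by positivity : (0 : ℝ) ≤ a * (sys j').moment β 1)]
    congr 1
    rw [hp_def]; field_simp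
  have hR1 : ((a * (sys j').moment β 1) ^ k) ^ p
      ≤ ((2 * (k : ℝ) + 1) * ((sys j').moment β k + (ε / 4) ^ (2 * k))) ^ p :=
    Real.rpow_le_rpow (by positivity) hfin' hp0
  have hR2 : ((2 * (k : ℝ) + 1) * ((sys j').moment β k + (ε / 4) ^ (2 * k))) ^ p
      = (2 * (k : ℝ) + 1) ^ p * ((sys j').moment β k + (ε / 4) ^ (2 * k)) ^ p :=
    Real.mul_rpow (by positivity) (by positivity)
  have hR4 : ((ε / 4) ^ (2 * k)) ^ p = ε / 4 := by
    rw [hpinv, Real.pow_rpow_inv_natCast (by positivity) hk0]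
  have hR3 : ((sys j').moment β k + (ε / 4) ^ (2 * k)) ^ p
      ≤ ((sys j').moment β k) ^ p + ε / 4 := by
    have h := Real.rpow_add_le_add_rpow hmk (by positivity : (0 : ℝ) ≤ (ε / 4) ^ (2 * k)) hp0 hp1
    rwa [hR4] at h
  have hx0 : 0 ≤ ((sys j').moment β k) ^ p := by positivity
  calc Real.sqrt a * Real.sqrt ((sys j').moment β 1)
      = ((a * (sys j').moment β 1) ^ k) ^ p := hL
    _ ≤ (2 * (k : ℝ) + 1) ^ p * ((sys j').moment β k + (ε / 4) ^ (2 * k)) ^ p := by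
        rw [← hR2]; exact hR1
    _ ≤ (1 + η) * (((sys j').moment β k) ^ p + ε / 4) :=
        mul_le_mul hθ hR3 (by positivity) (by linarith)
    _ ≤ (1 + η) * ((sys j).magnetisation β B + ε / 4 + ε / 4) :=
        mul_le_mul_of_nonneg_left (by linarith [hmag]) (by linarith)
    _ = ((sys j).magnetisation β B + ε / 2) + η * ((sys j).magnetisation β B + ε / 2) := by ring
    _ ≤ ((sys j).magnetisation β B + ε / 2) + η * (ob + ε) := by
        have h1 : (sys j).magnetisation β B + ε / 2 ≤ ob + ε := by linarith
        have h2 := mul_le_mul_of_nonneg_left h1 hη.le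
        linarith
    _ = (sys j).magnetisation β B + ε := by rw [hηε]; ring

/-- **Koma–Tasaki 1993, Corollary 2.2 for an `SO(2) = U(1)` symmetry: `m_s ≥ √2 σ` at every
temperature — PROVED** (KT93 Remark after Theorem 6.1, "the models with an `SO(2) = U(1)` invariance,
where we get a factor `√2` … quantum antiferromagnets with an XY-like anisotropy, or the electron pair
condensation problems in lattice electron systems", combined with Theorem 2.1 exactly as Corollary 2.2
combines Theorem 6.1 with Theorem 2.1).  Setting: a sequence of `Z2System`s `sys j` (i) free energies
converge, ii), iii), (2.3), (2.5) for `O^{(1)}_Λ = O_Λ`, `N_j → ∞`, `β > 0`) together with, at each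
volume, a second Hermitian component `O^{(2)}` (`‖O^{(2)}‖ ≤ ōN`) and a conserved generator `C`
(vi) `[H_Λ, C] = 0`) rotating `(O^{(1)}, O^{(2)})`: v) `[C, O^{(2)}] = ε O^{(1)}`, `[C, O^{(1)}] = -ε O^{(2)}`
with one fixed `ε ≠ 0` (for pairing, `C = N̂`, `ε = -2i`), and the commutator bound
`‖[O^{(2)}, O^{(1)}]‖ ≤ κ ō² N` uniformly (`κ = 2` under KT's iv); bounded-overlap densities such as the
d-wave pair field enter through their own `κ`).  Conclusion, in the form (2.13′): for every `B > 0` and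
`ε' > 0`, eventually in `j, j'`, `√2 (N_{j'}⁻²⟨(O^{(1)})²⟩_{Λ_{j'}}(0))^{1/2} ≤ N_j⁻¹⟨O^{(1)}⟩_{Λ_j}(B) + ε'`
(long-range order of the symmetric Gibbs states ⟹ order parameter under the symmetry-breaking field,
`Λ ↑ ℤ^d` first, then `B ↓ 0`; direction LRO ⟹ response only).
[cite: KomaTasaki1993, Corollary 2.2 (2.18) with Remark after Theorem 6.1 (SO(2) = U(1): factor √2); Theorem 2.1 (2.13); Theorem 6.1 (6.14)] -/
theorem kt93_corollary_2_2_u1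
    {hb ob κ : ℝ} {r : ℕ} {N : ℕ → ℕ} {n : ℕ → Type v} [∀ j, Fintype (n j)]
    [∀ j, DecidableEq (n j)] [∀ j, Nonempty (n j)] (sys : (j : ℕ) → Z2System (N j) hb ob r (n j))
    (O₂ C : (j : ℕ) → Matrix (n j) (n j) ℂ) {ε : ℂ} (hε : ε ≠ 0) (hκ0 : 0 ≤ κ)
    (hO₂h : ∀ j, (O₂ j).IsHermitian) (hC : ∀ j, Commute (sys j).hamiltonian (C j))
    (hrot₁ : ∀ j, C j * O₂ j - O₂ j * C j = ε • (sys j).order)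
    (hrot₂ : ∀ j, C j * (sys j).order - (sys j).order * C j = -(ε • O₂ j))
    (hO₂ : ∀ j, ‖O₂ j‖ ≤ ob * N j)
    (hκ : ∀ j, ‖O₂ j * (sys j).order - (sys j).order * O₂ j‖ ≤ κ * ob ^ 2 * N j)
    {β : ℝ} (hβ : 0 < β) (hN : Tendsto N atTop atTop)
    (hlim : ∀ B : ℝ, ∃ f : ℝ, Tendsto (fun j => (sys j).freeEnergy β B) atTop (𝓝 f)) :
    ∀ B : ℝ, 0 < B → ∀ ε' : ℝ, 0 < ε' → ∃ j₀ : ℕ, ∀ j j' : ℕ, j₀ ≤ j → j₀ ≤ j' →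
      Real.sqrt 2 * Real.sqrt ((sys j').moment β 1) ≤ (sys j).magnetisation β B + ε' := by
  refine sqrt_mul_sqrt_moment_le_of_chain sys hβ hN hlim (by norm_num : (0 : ℝ) ≤ 2)
    (fun k => 4 * κ * (k : ℝ) ^ 3 * 2 ^ k * ob ^ (2 * k)) ?_
  intro k hk j hNj
  exact (sys j).kt93_theorem_6_1_u1_fin (hO₂h j) (hC j) (hrot₁ j) (hrot₂ j) hε (hO₂ j) (hκ j) hκ0 β
    hk hNj

end Z2System

end SU2

end Literature.MathematicalPhysics.QuantumLattice.KomaTasaki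

end
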